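import Literature.NumberTheory.Transcendental.ClosingDichotomy
import Literature.NumberTheory.Transcendental.BakerNewPointsG
import Literature.NumberTheory.Transcendental.NumCondExponents
import Literature.NumberTheory.Transcendental.NumCondFamily
import HarnessLib

/-!
# Baker's method on `M_κ` at a general algebraic point: closing data, parameters, numerics

Topic: `Literature/NumberTheory/Transcendental`. Unit
`provefact-Literature.NumberTheory.Transcendental.s-efcbe22610` (fact `semistabilityTheorem_std`).
This file has three parts (three `noncomputable section` blocks, each with its own `/-! ## Part … -/`
header giving the mathematics):

**Part I — the data of the closing argument** (the general-point counterparts of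
`ClosingData.exists_bakerData` and `ClosingDichotomy.AdmissibleParams`):

* `GaGmE.Std.exists_reduced_multiple` — every point `w` of `Lie M_κ,ℂ` has a multiple `N·w`,
  `N ≥ 1`, which is REDUCED: each `E`-coordinate of `N·w` is a lattice vector or has no torsion;
* `GaGmE.Std.exists_bakerDataG` — for `Λ` with algebraic invariants, a `ℚ̄`-rational `𝔟` and a
  reduced `w ∈ Std.Alg`, a `BakerDataG` (`BakerFieldG.lean`) with period pair `L`, extension data
  `κ`, point `v = w` and `dd = dim 𝔟` algebraic directions spanning exactly `𝔟`;
* `GaGmE.Std.AdmissibleParamsG` — the admissible-parameter predicate of the scaled engine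
  `BakerDataG.engine₂` (`BakerNewPointsG.lean`), word for word `ClosingDichotomy.AdmissibleParams`
  for the general-point data; it is DISCHARGED in Part III (`admissibleParamsG_of_lt`), not assumed.

**Part II — the exponential parameter family** `GaGmE.Std.BakerDataG.FamilyG` (`S₀+1 = σ^n`,
`S = ℓσ^n`, `Θ = G^{aσ^{2n}}`, `T = 4nΘ^n`, `D' = 2(4n)^{dd}σΘ^{dd}`, `R = G^{bσ^{2n}}·2(nS+S₀)`,
`W = G^{naσ^{2n}+E₀σ^n}`) with its elementary clauses (`basic`), the zero-estimate numerics
(`numerics`) and the exponent inequality of the numerical condition (`exponent_ineq`).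

**Part III — the numerical condition along the family**: `sizes_le_W`, `ΘR_le`, `ΘD_le`, `ΘK_lt`,
`numCond₂_familyG` and finally **`GaGmE.Std.BakerDataG.admissibleParamsG_of_lt`**:
`AdmissibleParamsG B dd c` holds for every general-point Baker datum with `dd < n` and every `c > 0`
(the engine output at a reduced point is then read off `engine₂` in `SemistabilityStdOfPhilippon`).

Everything is proved; no named facts (`AdmissibleParamsG` is a predicate with arguments, used as
an explicit hypothesis and discharged, exactly as `AdmissibleParams`).

## References

* A. Baker, G. Wüstholz, *Logarithmic Forms and Diophantine Geometry*, CUP 2007, §6.8 (pp. 117–119;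
  p. 119 for the comparison of the estimates for `log |Ψ(s)|` behind Parts II–III).
-/

/-! ## Part I — the data of the closing argument -/

noncomputable section

open Module Submodule Complex
open scoped PeriodPair

namespace Literature.NumberTheory.Transcendental

namespace GaGmE

namespace Std

open LiePresentation

variable {β γ δ : Type} [Fintype β] [Fintype γ] [Fintype δ] [DecidableEq γ]

omit [Fintype β] [Fintype δ] [DecidableEq γ] in
/-- **Reduced multiples.** Every `w ∈ Lie M_κ,ℂ` has a multiple `N·w`, `N ≥ 1`, each of whose
`E`-coordinates is a lattice vector or has no torsion (`s·(N z_b) ∉ Λ` for all `s ≥ 1`): take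
`N` the product of the torsion orders of the torsion coordinates. [folklore] -/
theorem exists_reduced_multiple (L : PeriodPair) (w : β ⊕ (γ ⊕ δ) → ℂ) :
    ∃ N : ℕ, 0 < N ∧ ∀ b, ((N : ℂ) • w) (iz b) ∈ L.lattice ∨
      ∀ s : ℕ, s ≠ 0 → (s : ℂ) * ((N : ℂ) • w) (iz b) ∉ L.lattice := by
  classical
  -- per-coordinate torsion orders (`1` for a non-torsion coordinate)
  have hco : ∀ b, ∃ nb : ℕ, 0 < nb ∧ ((∃ m : ℕ, m ≠ 0 ∧ (m : ℂ) * w (iz b) ∈ L.lattice) →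
      (nb : ℂ) * w (iz b) ∈ L.lattice) := by
    intro b
    by_cases h : ∃ m : ℕ, m ≠ 0 ∧ (m : ℂ) * w (iz b) ∈ L.lattice
    · obtain ⟨m, hm, hmem⟩ := h
      exact ⟨m, Nat.pos_of_ne_zero hm, fun _ => hmem⟩
    · exact ⟨1, one_pos, fun h' => absurd h' h⟩
  choose nb hnb hmem using hco
  refine ⟨∏ b, nb b, Finset.prod_pos fun b _ => hnb b, fun b => ?_⟩
  simp only [Pi.smul_apply, smul_eq_mul]
  by_cases h : ∃ m : ℕ, m ≠ 0 ∧ (m : ℂ) * w (iz b) ∈ L.lattice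
  · left
    rw [← Finset.mul_prod_erase Finset.univ nb (Finset.mem_univ b)]
    push_cast
    rw [mul_comm ((nb b : ℂ)), mul_assoc]
    have := L.lattice.smul_mem ((∏ b' ∈ Finset.univ.erase b, nb b' : ℕ) : ℤ) (hmem b h)
    simpa [zsmul_eq_mul] using this
  · right
    intro s hs hsm
    push Not at h
    apply h (s * ∏ b', nb b') (Nat.mul_ne_zero hs (Finset.prod_ne_zero_iff.mpr fun b' _ => (hnb b').ne'))
    push_cast
    rw [mul_assoc]
    exact_mod_cast hsm

/-- **The general-point Baker data of the closing argument.** For `Λ` with algebraic invariants,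
a `ℚ̄`-rational `𝔟` and a REDUCED `w ∈ Std.Alg`, there is a `BakerDataG` with period pair `L`,
extension data `κ`, point `v = w`, `dd = dim 𝔟` directions spanning exactly `𝔟`.
[cite: BakerWustholz2007, §6.8 (p. 118: the data of the construction)] -/
theorem exists_bakerDataG (L : PeriodPair) (h₂ : IsAlgebraic ℚ L.g₂) (h₃ : IsAlgebraic ℚ L.g₃)
    (κM : δ → γ → Kbar) {𝔟 : Submodule ℂ (β ⊕ (γ ⊕ δ) → ℂ)} (hrat : IsKRational Kbar 𝔟)
    {w : β ⊕ (γ ⊕ δ) → ℂ} (hw : w ∈ Alg L κM)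
    (hred : ∀ b, w (iz b) ∈ L.lattice ∨ ∀ s : ℕ, s ≠ 0 → (s : ℂ) * w (iz b) ∉ L.lattice) :
    ∃ B : BakerDataG β γ δ, B.L = L ∧ B.κM = κM ∧ B.v = w ∧ B.dd = Module.finrank ℂ 𝔟 ∧
      Submodule.span ℂ (Set.range B.xs) = 𝔟 := by
  classical
  obtain ⟨b, -, hspan⟩ := hrat.exists_basis_ofK Kbar
  obtain ⟨hy, t', ht', ha⟩ := hw
  -- lattice coordinates of the lattice `E`-coordinates
  have hco : ∀ b', ∃ o : Option (ℤ × ℤ), (∀ mn, o = some mn → w (iz b') = (mn.1 : ℂ) * L.ω₁ + (mn.2 : ℂ) * L.ω₂) ∧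
      (o = none → ∀ s : ℕ, s ≠ 0 → (s : ℂ) * w (iz b') ∉ L.lattice) := by
    intro b'
    rcases hred b' with h | h
    · obtain ⟨m, n, hmn⟩ := PeriodPair.mem_lattice.mp h
      refine ⟨some (m, n), fun mn hmn' => ?_, fun h0 => ?_⟩
      · simp only [Option.some.injEq] at hmn'
        subst hmn'
        exact hmn.symm
      · exact absurd h0 (by simp)
    · exact ⟨none, ⟨fun mn h0 => absurd h0 (by simp), fun _ => h⟩⟩
  choose latCo hlat hnt using hco
  let B : BakerDataG β γ δ :=
    { L := L
      κM := κM
      h₂ := h₂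
      h₃ := h₃
      v := w
      hy := hy
      t' := t'
      ht' := ht'
      ha := ha
      latCo := latCo
      hlat := hlat
      hnt := hnt
      dd := Module.finrank ℂ 𝔟
      xs := fun m => ofK Kbar (b m)
      hxs := fun m k => isAlgebraic_coe_Kbar (b m k) }
  exact ⟨B, rfl, rfl, rfl, rfl, hspan⟩

variable [DecidableEq β] [DecidableEq δ]

/-- The admissible-parameter predicate of the scaled engine `BakerDataG.engine₂` for the general-point
datum `B` and the constant `c > 0` (word for word `ClosingDichotomy.AdmissibleParams`): parameters
`D', T, S₀, S, T″, R` with `T ≥ 1`, `D' ≥ 1`, `S ≥ 1`, Siegel feasibility, `R ≥ 2(nS + S₀) > 0`, the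
numerical condition `NumCond₂` for every coefficient vector within the Siegel bound (`S₁ = nS`,
`T' = nT″ + 1`), and the zero-estimate numerics. Discharged in the sequel (`admissibleParamsG_of_lt`).
[cite: BakerWustholz2007, §6.8 (p. 119: choice of D, T, S)] -/
def AdmissibleParamsG (B : BakerDataG β γ δ) (d𝔟 : ℕ) (c : ℝ) : Prop :=
  ∃ (D' T S₀ S T'' : ℕ) (R : ℝ), 0 < T ∧ 1 ≤ D' ∧ 1 ≤ S ∧
    (S₀ + 1) * T ^ B.dd < (D' + 1) ^ Fintype.card (β ⊕ (γ ⊕ δ)) ∧ 0 < R ∧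
    2 * (((Fintype.card (β ⊕ (γ ⊕ δ)) * S : ℕ) : ℝ) + S₀) ≤ R ∧
    (∀ ξ : BakerData.UIdx β γ δ D' → NumberField.RingOfIntegers B.K,
      (∀ u, NumberField.house ((ξ u : NumberField.RingOfIntegers B.K) : B.K) ≤ B.siegelHouseBound D' T S₀) →
        B.NumCond₂ ξ T S₀ (Fintype.card (β ⊕ (γ ⊕ δ)) * S) (Fintype.card (β ⊕ (γ ⊕ δ)) * T'' + 1) R) ∧
    ∀ e m : ℕ, m < Fintype.card (β ⊕ (γ ⊕ δ)) → d𝔟 * (Fintype.card (β ⊕ (γ ⊕ δ)) - m) ≤ e * Fintype.card (β ⊕ (γ ⊕ δ)) →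
      c * ((Fintype.card (β ⊕ (γ ⊕ δ)) * D' : ℕ) : ℝ) ^ Fintype.card (β ⊕ (γ ⊕ δ)) <
          (Nat.choose (T'' + e) e : ℝ) * ((S : ℝ) + 1) * ((Fintype.card (β ⊕ (γ ⊕ δ)) * D' : ℕ) : ℝ) ^ m ∧
      (d𝔟 * (Fintype.card (β ⊕ (γ ⊕ δ)) - m) < e * Fintype.card (β ⊕ (γ ⊕ δ)) →
        c * ((Fintype.card (β ⊕ (γ ⊕ δ)) * D' : ℕ) : ℝ) ^ Fintype.card (β ⊕ (γ ⊕ δ)) <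
          (Nat.choose (T'' + e) e : ℝ) * ((Fintype.card (β ⊕ (γ ⊕ δ)) * D' : ℕ) : ℝ) ^ m)

end Std

end GaGmE

end Literature.NumberTheory.Transcendental

end

/-!
## Part II — the exponential parameter family

At a general algebraic point the arithmetic of the points `s·v` grows like `(s+1)³` in the
exponent (`BakerFieldG.lean`: heights `≪ s²` of `℘(s z_b)`, `≪ s³` of the fibre coordinates), and
the derivatives of order `k < T'` of the auxiliary function at `s·v` have height `≪ k·(s+1)³`
(the degree in the generators grows with `k`). Without the Baker–Coates translation device this
cross term is paid by the extrapolation gain `(T-k)(S₀+1)·log(R/2(s+S₀))` only if `log R ≫ S²`,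
which forces the parameters `T, D` to be EXPONENTIAL in `S`. This file fixes such a one-parameter
family, indexed by `σ ∈ ℕ` (all exponents natural, one base `G ≥ 2`):

* `S₀ + 1 = σ^n`, `S = ℓσ^n`, `Θ = G^{a σ^{2n}}`, `T = 4nΘ^n`, `T″ = 2Θ^n - 1`,
  `D' = 2(4n)^{dd} σ Θ^{dd}`, `R = G^{bσ^{2n}}·2(nS + S₀)`, `W = G^{ω}`, `ω = naσ^{2n} + E₀σ^n`;

and PROVES for it: the elementary clauses of `AdmissibleParamsG` (`basic`: positivity, Siegel
feasibility with `q ≥ 2p`, `R ≥ 2(nS+S₀)`, `nT″+1 ≤ T/2`), the zero-estimate numerics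
(`numerics`: for `ℓ > c·κ^n·n!` and `Θ > c·κ^n·n!·σ^n`), the domination of the linear sizes by
`W` (`sizes_le_W`), and **the exponent inequality** `X₁ + ω·X₂ + Y < b·σ^{2n}·(T-T')(S₀+1)` of
the numerical condition (`exponent_ineq`, for `b ≥ b₀(n, dd, h, hdeg, #Gen, ℓ)` and `σ`, `Θ`
beyond explicit thresholds), every term being bounded by a multiple of `σ^{3n}Θ^n`.
Everything is proved; no named facts.

## References

* A. Baker, G. Wüstholz, *Logarithmic Forms and Diophantine Geometry*, CUP 2007, §6.8 (p. 119:
  the comparison of the estimates for `log |Ψ(s)|`).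
-/

noncomputable section

open Finset
open scoped PeriodPair

namespace Literature.NumberTheory.Transcendental

namespace GaGmE

namespace Std

namespace BakerDataG

open BakerData.Family (κD S₀ S₀_add_one)

/-! ### The family -/

/-- The exponential parameter family of Baker's method on `M_κ` at a general point: exponents
`a, b`, ratio `ℓ ≥ 1`, base `G ≥ 2`. [cite: BakerWustholz2007, §6.8 (p. 119)] -/
structure FamilyG where
  /-- exponent of `Θ = G^{aσ^{2n}}` -/
  a : ℕ
  /-- exponent of the radius ratio `G^{bσ^{2n}}` -/
  b : ℕ
  /-- ratio `S/(S₀+1) = ℓ` -/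
  ℓ : ℕ
  /-- the base -/
  G : ℕ
  /-- `ℓ ≥ 1` -/
  hℓ : 1 ≤ ℓ
  /-- `G ≥ 2` -/
  hG : 2 ≤ G
  /-- `a ≥ 1` -/
  ha : 1 ≤ a

namespace FamilyG

variable (F : FamilyG) (n dd : ℕ)

/-- `Θ = G^{aσ^{2n}}`. [folklore] -/
def Θ (σ : ℕ) : ℕ := F.G ^ (F.a * σ ^ (2 * n))
/-- `T = 4n Θ^n`. [folklore] -/
def T (σ : ℕ) : ℕ := 4 * n * F.Θ n σ ^ n
/-- `T″ = 2Θ^n - 1`. [folklore] -/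
def T₂ (σ : ℕ) : ℕ := 2 * F.Θ n σ ^ n - 1
/-- `T' = nT″ + 1`. [folklore] -/
def T' (σ : ℕ) : ℕ := n * F.T₂ n σ + 1
/-- `D' = 2(4n)^{dd} σ Θ^{dd}`. [folklore] -/
def D' (σ : ℕ) : ℕ := 2 * (4 * n) ^ dd * σ * F.Θ n σ ^ dd
/-- `D = nD'`. [folklore] -/
def Dn (σ : ℕ) : ℕ := n * F.D' n dd σ
/-- `S = ℓσ^n`. [folklore] -/
def S (σ : ℕ) : ℕ := F.ℓ * σ ^ n
/-- `S₁ = nS`. [folklore] -/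
def S₁ (σ : ℕ) : ℕ := n * F.S n σ
/-- `R = G^{bσ^{2n}} · 2(nS + S₀)`. [folklore] -/
def R (σ : ℕ) : ℝ := (F.G : ℝ) ^ (F.b * σ ^ (2 * n)) * (2 * (((n * F.S n σ : ℕ) : ℝ) + S₀ n σ))
/-- A natural upper bound for `R`: `R' = 2(nℓ+1)σ^n G^{bσ^{2n}}`. [folklore] -/
def R' (σ : ℕ) : ℕ := 2 * (n * F.ℓ + 1) * σ ^ n * F.G ^ (F.b * σ ^ (2 * n))
/-- The slack coefficient of the `W`-exponent: `E₀ = hdeg·κ + 8n + nℓ + κ + 3`. [folklore] -/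
def E₀ (hdeg : ℕ) : ℕ := hdeg * κD n dd + 8 * n + n * F.ℓ + κD n dd + 3
/-- The `W`-exponent `ω = naσ^{2n} + E₀σ^n` (`W = G^ω`). [folklore] -/
def ω (hdeg σ : ℕ) : ℕ := n * F.a * σ ^ (2 * n) + F.E₀ n dd hdeg * σ ^ n

/-! ### The elementary clauses -/

/-- `1 ≤ Θ`. [folklore] -/
theorem one_le_Θ (σ : ℕ) : 1 ≤ F.Θ n σ := Nat.one_le_pow _ _ (by have := F.hG; omega)

/-- `1 ≤ Θ^k`. [folklore] -/
theorem one_le_Θ_pow (σ k : ℕ) : 1 ≤ F.Θ n σ ^ k := Nat.one_le_pow _ _ (F.one_le_Θ n σ)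

/-- `T > 0` for `n ≥ 1`. [folklore] -/
theorem T_pos (hn : 1 ≤ n) (σ : ℕ) : 0 < F.T n σ := by
  unfold T; have := F.one_le_Θ_pow n σ n; positivity

/-- `n T″ + 1 ≤ T / 2` for `n ≥ 1`. [folklore] -/
theorem orders_le (hn : 1 ≤ n) (σ : ℕ) : n * F.T₂ n σ + 1 ≤ F.T n σ / 2 := by
  unfold T T₂
  have h1 := F.one_le_Θ_pow n σ n
  set x := F.Θ n σ ^ n with hx
  have e : 4 * n * x / 2 = 2 * n * x := by
    rw [show 4 * n * x = 2 * (2 * n * x) by ring, Nat.mul_div_cancel_left _ two_pos]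
  rw [e, Nat.mul_sub, mul_one]
  have : n ≤ n * (2 * x) := Nat.le_mul_of_pos_right n (by omega)
  calc n * (2 * x) - n + 1 ≤ n * (2 * x) := by omega
    _ = 2 * n * x := by ring

/-- `T″ ≥ Θ^n`. [folklore] -/
theorem pow_le_T₂ (σ : ℕ) : F.Θ n σ ^ n ≤ F.T₂ n σ := by
  unfold T₂; have := F.one_le_Θ_pow n σ n; omega

/-- `T' ≤ 2nΘ^n`. [folklore] -/
theorem T'_le (hn : 1 ≤ n) (σ : ℕ) : F.T' n σ ≤ 2 * n * F.Θ n σ ^ n := by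
  unfold T' T₂
  have hpos := F.one_le_Θ_pow n σ n
  have : n * (2 * F.Θ n σ ^ n - 1) + 1 ≤ n * (2 * F.Θ n σ ^ n) := by
    rw [Nat.mul_sub, mul_one]
    have : n ≤ n * (2 * F.Θ n σ ^ n) := Nat.le_mul_of_pos_right n (by omega)
    omega
  linarith

/-- `T - T' ≥ 2nΘ^n` (`n ≥ 1`). [folklore] -/
theorem two_n_pow_le_T_sub (hn : 1 ≤ n) (σ : ℕ) : 2 * n * F.Θ n σ ^ n ≤ F.T n σ - F.T' n σ := by
  have h := F.orders_le n hn σ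
  unfold T'
  unfold T at *
  set x := F.Θ n σ ^ n with hx
  have e : 4 * n * x / 2 = 2 * n * x := by
    rw [show 4 * n * x = 2 * (2 * n * x) by ring, Nat.mul_div_cancel_left _ two_pos]
  rw [e] at h
  have e2 : 4 * n * x = 2 * n * x + 2 * n * x := by ring
  omega

/-- `D' ≥ 1` for `n, σ ≥ 1`. [folklore] -/
theorem one_le_D' (hn : 1 ≤ n) {σ : ℕ} (hσ : 1 ≤ σ) : 1 ≤ F.D' n dd σ := by
  unfold D'
  have := F.one_le_Θ_pow n σ dd
  have : 1 ≤ (4 * n) ^ dd := Nat.one_le_pow _ _ (by omega)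
  calc 1 ≤ 2 * 1 * 1 * 1 := by norm_num
    _ ≤ 2 * (4 * n) ^ dd * σ * F.Θ n σ ^ dd := by gcongr

/-- `S ≥ 1` for `σ ≥ 1`. [folklore] -/
theorem one_le_S {σ : ℕ} (hσ : 1 ≤ σ) : 1 ≤ F.S n σ := by
  unfold S; exact Nat.one_le_iff_ne_zero.mpr (Nat.mul_ne_zero (by have := F.hℓ; omega) (by positivity))

/-- `S₁ + 1 ≤ (nℓ + 1) σ^n` (`σ ≥ 1`). [folklore] -/
theorem S₁_add_one_le {σ : ℕ} (hσ : 1 ≤ σ) : F.S₁ n σ + 1 ≤ (n * F.ℓ + 1) * σ ^ n := by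
  unfold S₁ S
  have := Nat.one_le_pow n σ hσ
  nlinarith

/-- `D = κ_D · σ · Θ^{dd}`. [folklore] -/
theorem Dn_eq (σ : ℕ) : F.Dn n dd σ = κD n dd * σ * F.Θ n σ ^ dd := by
  unfold Dn D' BakerData.Family.κD; ring

/-- `2p ≤ q`: `2(S₀+1)T^{dd} ≤ (D'+1)^n` (`n, σ ≥ 1`). [folklore] -/
theorem two_p_le_q (hn : 1 ≤ n) {σ : ℕ} (hσ : 1 ≤ σ) :
    2 * ((S₀ n σ + 1) * F.T n σ ^ dd) ≤ (F.D' n dd σ + 1) ^ n := by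
  rw [S₀_add_one n hσ]
  unfold T D'
  set X := F.Θ n σ with hX
  have hσeq : σ ^ n * (X ^ n) ^ dd = (σ * X ^ dd) ^ n := by
    rw [← pow_mul, mul_pow, ← pow_mul, mul_comm n dd]
  have h2 : 2 * (4 * n) ^ dd ≤ 2 ^ n * ((4 * n) ^ dd) ^ n := by
    have hb : 1 ≤ (4 * n) ^ dd := Nat.one_le_pow _ _ (by omega)
    calc 2 * (4 * n) ^ dd = 2 ^ 1 * ((4 * n) ^ dd) ^ 1 := by ring
      _ ≤ 2 ^ n * ((4 * n) ^ dd) ^ n :=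
        Nat.mul_le_mul (Nat.pow_le_pow_right (by omega) hn) (Nat.pow_le_pow_right hb hn)
  calc 2 * (σ ^ n * (4 * n * X ^ n) ^ dd) = 2 * (4 * n) ^ dd * (σ ^ n * (X ^ n) ^ dd) := by
        rw [mul_pow (4 * n) (X ^ n) dd]; ring
    _ = 2 * (4 * n) ^ dd * (σ * X ^ dd) ^ n := by rw [hσeq]
    _ ≤ (2 ^ n * ((4 * n) ^ dd) ^ n) * (σ * X ^ dd) ^ n := Nat.mul_le_mul_right _ h2
    _ = (2 * (4 * n) ^ dd * σ * X ^ dd) ^ n := by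
        rw [show 2 * (4 * n) ^ dd * σ * X ^ dd = (2 * (4 * n) ^ dd) * (σ * X ^ dd) by ring,
          mul_pow (2 * (4 * n) ^ dd) (σ * X ^ dd) n, mul_pow 2 ((4 * n) ^ dd) n]
    _ ≤ (2 * (4 * n) ^ dd * σ * X ^ dd + 1) ^ n := Nat.pow_le_pow_left (Nat.le_succ _) n

/-- **Siegel feasibility**: `(S₀+1) T^{dd} < (D'+1)^n`. [folklore] -/
theorem siegel_feasible (hn : 1 ≤ n) {σ : ℕ} (hσ : 1 ≤ σ) :
    (S₀ n σ + 1) * F.T n σ ^ dd < (F.D' n dd σ + 1) ^ n := by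
  have h := F.two_p_le_q n dd hn hσ
  have hpos : 0 < (S₀ n σ + 1) * F.T n σ ^ dd := Nat.mul_pos (Nat.succ_pos _) (pow_pos (F.T_pos n hn σ) _)
  omega

/-- `2(nS + S₀) ≤ R` and `0 < R` for `n, σ ≥ 1`. [folklore] -/
theorem R_bounds (hn : 1 ≤ n) {σ : ℕ} (hσ : 1 ≤ σ) :
    0 < F.R n σ ∧ 2 * ((((n * F.S n σ : ℕ)) : ℝ) + S₀ n σ) ≤ F.R n σ := by
  unfold R
  have hG1 : (1 : ℝ) ≤ F.G := by have := F.hG; exact_mod_cast (by omega : 1 ≤ F.G)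
  have hσ' : (1 : ℝ) ≤ (F.G : ℝ) ^ (F.b * σ ^ (2 * n)) := one_le_pow₀ hG1
  have h1 : 1 ≤ n * F.S n σ :=
    Nat.one_le_iff_ne_zero.mpr (Nat.mul_ne_zero (by omega) (by have := F.one_le_S n hσ; omega))
  have h1' : (1 : ℝ) ≤ ((n * F.S n σ : ℕ) : ℝ) := by exact_mod_cast h1
  have h0 : (0 : ℝ) ≤ (S₀ n σ : ℝ) := Nat.cast_nonneg _
  have hpos : (0 : ℝ) < 2 * (((n * F.S n σ : ℕ) : ℝ) + S₀ n σ) := by linarith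
  constructor
  · positivity
  · calc 2 * (((n * F.S n σ : ℕ) : ℝ) + S₀ n σ) = 1 * (2 * (((n * F.S n σ : ℕ) : ℝ) + S₀ n σ)) := by ring
      _ ≤ (F.G : ℝ) ^ (F.b * σ ^ (2 * n)) * (2 * (((n * F.S n σ : ℕ) : ℝ) + S₀ n σ)) :=
        mul_le_mul_of_nonneg_right hσ' hpos.le

/-- `R ≤ R'` along the family. [folklore] -/
theorem R_le_R' {σ : ℕ} (hσ : 1 ≤ σ) : F.R n σ ≤ (F.R' n σ : ℝ) := by
  unfold R R'
  have hS : (((n * F.S n σ : ℕ)) : ℝ) + S₀ n σ ≤ ((n * F.ℓ + 1 : ℕ) : ℝ) * (σ : ℝ) ^ n := by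
    have h1 : (S₀ n σ : ℝ) + 1 = (σ : ℝ) ^ n := by exact_mod_cast S₀_add_one n hσ
    unfold S; push_cast at h1 ⊢; nlinarith
  have hpos : (0 : ℝ) ≤ (F.G : ℝ) ^ (F.b * σ ^ (2 * n)) := by positivity
  calc (F.G : ℝ) ^ (F.b * σ ^ (2 * n)) * (2 * ((((n * F.S n σ : ℕ)) : ℝ) + S₀ n σ))
      ≤ (F.G : ℝ) ^ (F.b * σ ^ (2 * n)) * (2 * (((n * F.ℓ + 1 : ℕ) : ℝ) * (σ : ℝ) ^ n)) := by nlinarith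
    _ = ((2 * (n * F.ℓ + 1) * σ ^ n * F.G ^ (F.b * σ ^ (2 * n)) : ℕ) : ℝ) := by push_cast; ring

/-! ### The zero-estimate numerics -/

/-- **The zero-estimate numerics hold for the family** (all orders `e`), provided
`ℓ > c·κ^n·n!` and `Θ > c·κ^n·n!·σ^n` (`κ = n·2(4n)^{dd}`, `D = nD' = κσΘ^{dd}`): for `m < n` and
`dd·(n - m) ≤ e·n`, `c·D^n < binom(T″+e, e)·(S+1)·D^m`, and `c·D^n < binom(T″+e, e)·D^m` when the
index inequality is strict. [cite: BakerWustholz2007, §6.8 (p. 119: "ℓS'T^d ≫ D^n")] -/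
theorem numerics (hn : 1 ≤ n) (hdd : dd < n) {c : ℝ} (hc : 0 < c)
    (hℓc : c * ((κD n dd : ℕ) : ℝ) ^ n * n.factorial < F.ℓ) {σ : ℕ} (hσ : 1 ≤ σ)
    (hΘK : c * ((κD n dd : ℕ) : ℝ) ^ n * n.factorial * (σ : ℝ) ^ n < F.Θ n σ) (e m : ℕ) (hm : m < n)
    (hidx : dd * (n - m) ≤ e * n) :
    (c * ((n * F.D' n dd σ : ℕ) : ℝ) ^ n <
        (Nat.choose (F.T₂ n σ + e) e : ℝ) * ((F.S n σ : ℝ) + 1) * ((n * F.D' n dd σ : ℕ) : ℝ) ^ m) ∧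
    (dd * (n - m) < e * n →
      c * ((n * F.D' n dd σ : ℕ) : ℝ) ^ n < (Nat.choose (F.T₂ n σ + e) e : ℝ) * ((n * F.D' n dd σ : ℕ) : ℝ) ^ m) := by
  -- reduce to `e ≤ n` by monotonicity of `choose`
  set e' : ℕ := min e n with he'
  have he'n : e' ≤ n := min_le_right _ _
  have he'e : e' ≤ e := min_le_left _ _
  have hidx' : dd * (n - m) ≤ e' * n := by
    rcases le_total e n with h | h
    · rw [he', min_eq_left h]; exact hidx
    · rw [he', min_eq_right h]; nlinarith [Nat.sub_le n m, hdd.le]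
  have hstr' : dd * (n - m) < e * n → dd * (n - m) < e' * n := by
    intro hs
    rcases le_total e n with h | h
    · rw [he', min_eq_left h]; exact hs
    · rw [he', min_eq_right h]
      have : dd * (n - m) ≤ dd * n := Nat.mul_le_mul_left _ (Nat.sub_le _ _)
      have : dd * n < n * n := Nat.mul_lt_mul_of_lt_of_le hdd le_rfl (by omega)
      omega
  have hch : (Nat.choose (F.T₂ n σ + e') e' : ℝ) ≤ (Nat.choose (F.T₂ n σ + e) e : ℝ) := by
    exact_mod_cast choose_add_mono _ he'e
  -- notation
  set κ : ℝ := ((κD n dd : ℕ) : ℝ) with hκ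
  set X : ℝ := (F.Θ n σ : ℝ) with hX
  have hκ1 : 1 ≤ κ := by
    rw [hκ]; exact_mod_cast Nat.one_le_iff_ne_zero.mpr (by
      unfold BakerData.Family.κD; exact Nat.mul_ne_zero (by omega) (Nat.mul_ne_zero two_ne_zero (pow_ne_zero _ (by omega))))
  have hσ1 : (1 : ℝ) ≤ σ := by exact_mod_cast hσ
  have hX1 : (1 : ℝ) ≤ X := by rw [hX]; exact_mod_cast F.one_le_Θ n σ
  have hσ0 : (0 : ℝ) < σ := by linarith
  have hκ0 : (0 : ℝ) < κ := by linarith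
  have hX0 : (0 : ℝ) < X := by linarith
  have hmn : m ≤ n := hm.le
  have hD : ((n * F.D' n dd σ : ℕ) : ℝ) = κ * (σ : ℝ) * X ^ dd := by
    rw [hκ, hX, show n * F.D' n dd σ = F.Dn n dd σ from rfl, F.Dn_eq]; push_cast; ring
  have hDpos : (0 : ℝ) < ((n * F.D' n dd σ : ℕ) : ℝ) := by rw [hD]; positivity
  -- `X^{n e'} / e'! ≤ choose(T₂ + e', e')`
  have hchoose : X ^ (n * e') / e'.factorial ≤ (Nat.choose (F.T₂ n σ + e') e' : ℝ) := by
    have hM := Nat.pow_le_choose (α := ℝ) e' (F.T₂ n σ + e')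
    rw [show F.T₂ n σ + e' + 1 - e' = F.T₂ n σ + 1 by omega] at hM
    refine le_trans (div_le_div_of_nonneg_right ?_ (by positivity)) hM
    push_cast
    rw [pow_mul]
    refine pow_le_pow_left₀ (by positivity) ?_ e'
    have : ((F.Θ n σ ^ n : ℕ) : ℝ) ≤ (F.T₂ n σ : ℝ) := by exact_mod_cast F.pow_le_T₂ n σ
    push_cast at this; rw [hX]; linarith
  have hS : (F.ℓ : ℝ) * (σ : ℝ) ^ n ≤ (F.S n σ : ℝ) + 1 := by unfold S; push_cast; linarith
  have hℓ1 : (1 : ℝ) ≤ F.ℓ := by exact_mod_cast F.hℓ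
  have hefact : ((e'.factorial : ℕ) : ℝ) ≤ n.factorial := by exact_mod_cast Nat.factorial_le he'n
  have hefpos : (0 : ℝ) < e'.factorial := by exact_mod_cast e'.factorial_pos
  set K : ℝ := c * κ ^ n * n.factorial with hK
  have hK0 : 0 < K := by positivity
  -- the common core: `c D^n ≤ K σ^n X^{dd n}` and `D^m = κ^m σ^m X^{dd m}`
  have hsplit : ((n * F.D' n dd σ : ℕ) : ℝ) ^ n =
      ((n * F.D' n dd σ : ℕ) : ℝ) ^ (n - m) * ((n * F.D' n dd σ : ℕ) : ℝ) ^ m := by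
    rw [← pow_add, Nat.sub_add_cancel hmn]
  have hcore : c * ((n * F.D' n dd σ : ℕ) : ℝ) ^ (n - m) * (e'.factorial : ℝ) ≤
      K * (σ : ℝ) ^ (n - m) * X ^ (dd * (n - m)) := by
    rw [hD, mul_pow, mul_pow, ← pow_mul]
    have h1 : κ ^ (n - m) ≤ κ ^ n := pow_le_pow_right₀ hκ1 (Nat.sub_le _ _)
    have h0 : (0 : ℝ) ≤ (σ : ℝ) ^ (n - m) * X ^ (dd * (n - m)) := by positivity
    calc c * (κ ^ (n - m) * (σ : ℝ) ^ (n - m) * X ^ (dd * (n - m))) * (e'.factorial : ℝ)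
        = (c * κ ^ (n - m) * e'.factorial) * ((σ : ℝ) ^ (n - m) * X ^ (dd * (n - m))) := by ring
      _ ≤ (c * κ ^ n * n.factorial) * ((σ : ℝ) ^ (n - m) * X ^ (dd * (n - m))) := by
          refine mul_le_mul_of_nonneg_right ?_ h0
          exact mul_le_mul (mul_le_mul_of_nonneg_left h1 hc.le) hefact hefpos.le (by positivity)
      _ = K * (σ : ℝ) ^ (n - m) * X ^ (dd * (n - m)) := by rw [hK]; ring
  have hXidx : X ^ (dd * (n - m)) ≤ X ^ (n * e') := pow_le_pow_right₀ hX1 (by rw [mul_comm n]; exact hidx')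
  have hσnm : (σ : ℝ) ^ (n - m) ≤ (σ : ℝ) ^ n := pow_le_pow_right₀ hσ1 (Nat.sub_le _ _)
  have hDm : (0 : ℝ) < ((n * F.D' n dd σ : ℕ) : ℝ) ^ m := pow_pos hDpos m
  constructor
  · -- non-strict: `c D^{n-m} e'! ≤ K σ^{n-m} X^{dd(n-m)} < ℓ σ^n X^{n e'} ≤ (X^{ne'}/e'!)·e'!·(S+1)`
    have hmain : c * ((n * F.D' n dd σ : ℕ) : ℝ) ^ (n - m) <
        (X ^ (n * e') / e'.factorial) * ((F.S n σ : ℝ) + 1) := by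
      rw [div_mul_eq_mul_div, lt_div_iff₀ hefpos]
      calc c * ((n * F.D' n dd σ : ℕ) : ℝ) ^ (n - m) * (e'.factorial : ℝ)
          ≤ K * (σ : ℝ) ^ (n - m) * X ^ (dd * (n - m)) := hcore
        _ ≤ K * (σ : ℝ) ^ n * X ^ (n * e') := by
            exact mul_le_mul (mul_le_mul_of_nonneg_left hσnm hK0.le) hXidx (by positivity) (by positivity)
        _ < (F.ℓ : ℝ) * (σ : ℝ) ^ n * X ^ (n * e') := by
            have : K < F.ℓ := hℓc
            have hp : (0 : ℝ) < (σ : ℝ) ^ n * X ^ (n * e') := by positivity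
            nlinarith
        _ ≤ X ^ (n * e') * ((F.S n σ : ℝ) + 1) := by
            rw [mul_comm (X ^ (n * e'))]
            exact mul_le_mul_of_nonneg_right hS (by positivity)
    calc c * ((n * F.D' n dd σ : ℕ) : ℝ) ^ n
        = (c * ((n * F.D' n dd σ : ℕ) : ℝ) ^ (n - m)) * ((n * F.D' n dd σ : ℕ) : ℝ) ^ m := by rw [hsplit]; ring
      _ < (X ^ (n * e') / e'.factorial * ((F.S n σ : ℝ) + 1)) * ((n * F.D' n dd σ : ℕ) : ℝ) ^ m :=
          mul_lt_mul_of_pos_right hmain hDm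
      _ ≤ (Nat.choose (F.T₂ n σ + e) e : ℝ) * ((F.S n σ : ℝ) + 1) * ((n * F.D' n dd σ : ℕ) : ℝ) ^ m := by
          refine mul_le_mul_of_nonneg_right (mul_le_mul_of_nonneg_right (hchoose.trans hch) (by positivity)) hDm.le
  · -- strict: `K σ^{n-m} X^{dd(n-m)} ≤ (K σ^n) X^{dd(n-m)} < X · X^{dd(n-m)} ≤ X^{n e'}`
    intro hstrict
    have hs' := hstr' hstrict
    have hXidx' : X * X ^ (dd * (n - m)) ≤ X ^ (n * e') := by
      rw [← pow_succ']
      exact pow_le_pow_right₀ hX1 (by rw [mul_comm n]; omega)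
    have hmain : c * ((n * F.D' n dd σ : ℕ) : ℝ) ^ (n - m) < X ^ (n * e') / e'.factorial := by
      rw [lt_div_iff₀ hefpos]
      calc c * ((n * F.D' n dd σ : ℕ) : ℝ) ^ (n - m) * (e'.factorial : ℝ)
          ≤ K * (σ : ℝ) ^ (n - m) * X ^ (dd * (n - m)) := hcore
        _ ≤ K * (σ : ℝ) ^ n * X ^ (dd * (n - m)) :=
            mul_le_mul_of_nonneg_right (mul_le_mul_of_nonneg_left hσnm hK0.le) (by positivity)
        _ < X * X ^ (dd * (n - m)) := by
            have : K * (σ : ℝ) ^ n < X := hΘK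
            exact mul_lt_mul_of_pos_right this (by positivity)
        _ ≤ X ^ (n * e') := hXidx'
    calc c * ((n * F.D' n dd σ : ℕ) : ℝ) ^ n
        = (c * ((n * F.D' n dd σ : ℕ) : ℝ) ^ (n - m)) * ((n * F.D' n dd σ : ℕ) : ℝ) ^ m := by rw [hsplit]; ring
      _ < (X ^ (n * e') / e'.factorial) * ((n * F.D' n dd σ : ℕ) : ℝ) ^ m := mul_lt_mul_of_pos_right hmain hDm
      _ ≤ (Nat.choose (F.T₂ n σ + e) e : ℝ) * ((n * F.D' n dd σ : ℕ) : ℝ) ^ m :=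
          mul_le_mul_of_nonneg_right (hchoose.trans hch) hDm.le

/-! ### The exponents of the numerical condition -/

section Exponents

variable (h hdeg cg : ℕ)

/-- `E_T = expE D T`. [folklore] -/
def ET (σ : ℕ) : ℕ := 2 * F.Dn n dd σ + F.T n σ * 3 + (F.Dn n dd σ * hdeg + 2 * F.T n σ)
/-- `E' = expE D T'`. [folklore] -/
def E' (σ : ℕ) : ℕ := 2 * F.Dn n dd σ + F.T' n σ * 3 + (F.Dn n dd σ * hdeg + 2 * F.T' n σ)
/-- `P₁ = D·hdeg + 2T'`. [folklore] -/
def P₁ (σ : ℕ) : ℕ := F.Dn n dd σ * hdeg + 2 * F.T' n σ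
/-- The `G`-exponent of the envelope of `houseBound`. [folklore] -/
def NA₁ (σ : ℕ) : ℕ := (1 + cg * (S₀ n σ + 1) ^ 3) * F.ET n dd hdeg σ + 2 * F.T n σ + F.Dn n dd σ +
  (S₀ n σ + 1) ^ 3 * (F.Dn n dd σ * hdeg + 2 * F.T n σ)
/-- The `G`-exponent of the envelope of `lineValBound` (without `A`). [folklore] -/
def L₁ (σ : ℕ) : ℕ := 2 * F.T' n σ + 3 + F.Dn n dd σ + (F.S₁ n σ + 1) ^ 3 * F.P₁ n dd hdeg σ
/-- The `W`-exponent of the envelope of `lineValBound` (without `A`). [folklore] -/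
def L₂ (σ : ℕ) : ℕ := 2 * F.T' n σ + 3 * n
/-- The `G`-exponent of the envelope of `|d_s|^{E}`. [folklore] -/
def dE (σ : ℕ) : ℕ := (1 + cg * (F.S₁ n σ + 1) ^ 3) * F.E' n dd hdeg σ
/-- The `G`-exponent of the envelope of the growth factor. [folklore] -/
def gE (σ : ℕ) : ℕ := F.Dn n dd σ * (1 + (F.R' n σ + 1) ^ 2 * F.G ^ 2)
/-- Total `G`-exponent of the left-hand side (`h ≥ 1` embeddings). [folklore] -/
def X₁ (σ : ℕ) : ℕ := 2 * F.T' n σ + 3 + F.gE n dd σ + h * F.dE n dd hdeg cg σ + (h - 1) * F.L₁ n dd hdeg σ +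
  h * F.NA₁ n dd hdeg cg σ
/-- Total `W`-exponent of the left-hand side. [folklore] -/
def X₂ (σ : ℕ) : ℕ := 2 * F.T' n σ + n + 2 * n + (h - 1) * F.L₂ n σ + h * F.T n σ
/-- The `G`-exponent of the right-hand side: `Y = D·(1 + (S₁+1)³)`. [folklore] -/
def Y (σ : ℕ) : ℕ := F.Dn n dd σ * (1 + (F.S₁ n σ + 1) ^ 3)
/-- The saving exponent `(T - T')(S₀+1)`. [folklore] -/
def Msave (σ : ℕ) : ℕ := (F.T n σ - F.T' n σ) * (S₀ n σ + 1)
/-- The coefficient of `σ^{3n}Θ^n` collecting the `T`-type terms. [folklore] -/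
def CA : ℕ := 4 * n + 5 + h * (10 * n * (1 + cg * (n * F.ℓ + 1) ^ 3) + (4 * n + 3 + 4 * n * (n * F.ℓ + 1) ^ 3) +
  4 * n * (9 + 5 * cg))
/-- The coefficient collecting the `D`-type terms. [folklore] -/
def CD : ℕ := 2 + (n * F.ℓ + 1) ^ 3 + h * ((2 + hdeg) * (1 + cg * (n * F.ℓ + 1) ^ 3) + (1 + hdeg * (n * F.ℓ + 1) ^ 3) +
  (3 + 2 * hdeg + cg * (2 + hdeg)))
/-- **The required lower bound `b₀` on `b`.** [folklore] -/
def b₀ : ℕ := F.CA n h cg + 2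

variable {n dd}

/-- The unit `N = σ^{3n}Θ^n` dominates `Θ^n` and `1`. [folklore] -/
theorem unit_ge {σ : ℕ} (hσ : 1 ≤ σ) : 1 ≤ σ ^ (3 * n) * F.Θ n σ ^ n ∧ F.Θ n σ ^ n ≤ σ ^ (3 * n) * F.Θ n σ ^ n := by
  have h1 : 1 ≤ σ ^ (3 * n) := Nat.one_le_pow _ _ hσ
  have h2 := F.one_le_Θ_pow n σ n
  exact ⟨Nat.one_le_iff_ne_zero.mpr (Nat.mul_ne_zero (by omega) (by omega)), Nat.le_mul_of_pos_left _ (by omega)⟩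

/-- `(S₁+1)³ ≤ (nℓ+1)³ σ^{3n}`. [folklore] -/
theorem S₁_cube_le {σ : ℕ} (hσ : 1 ≤ σ) : (F.S₁ n σ + 1) ^ 3 ≤ (n * F.ℓ + 1) ^ 3 * σ ^ (3 * n) := by
  have := Nat.pow_le_pow_left (F.S₁_add_one_le n hσ) 3
  rw [mul_pow, ← pow_mul, mul_comm n 3] at this
  exact this

/-- **The `D`-type terms**: if `K·κ_D·σ ≤ Θ` and `dd < n` then `K·(D·σ^{3n}) ≤ σ^{3n}Θ^n`. [folklore] -/
theorem Dn_cube_le (hdd : dd < n) {K σ : ℕ} (hK : K * κD n dd * σ ≤ F.Θ n σ) :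
    K * (F.Dn n dd σ * σ ^ (3 * n)) ≤ σ ^ (3 * n) * F.Θ n σ ^ n := by
  rw [F.Dn_eq]
  have h1 : F.Θ n σ * F.Θ n σ ^ dd ≤ F.Θ n σ ^ n := by
    rw [← pow_succ']; exact Nat.pow_le_pow_right (F.one_le_Θ n σ) (by omega)
  calc K * (κD n dd * σ * F.Θ n σ ^ dd * σ ^ (3 * n)) = (K * κD n dd * σ) * F.Θ n σ ^ dd * σ ^ (3 * n) := by ring
    _ ≤ F.Θ n σ * F.Θ n σ ^ dd * σ ^ (3 * n) := by gcongr
    _ ≤ F.Θ n σ ^ n * σ ^ (3 * n) := Nat.mul_le_mul_right _ h1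
    _ = σ ^ (3 * n) * F.Θ n σ ^ n := mul_comm _ _

/-- `T·σ^{3n} = 4n·N`. [folklore] -/
theorem T_mul_cube (σ : ℕ) : F.T n σ * σ ^ (3 * n) = 4 * n * (σ ^ (3 * n) * F.Θ n σ ^ n) := by
  unfold T; ring

/-- `T'·σ^{3n} ≤ 2n·N`. [folklore] -/
theorem T'_mul_cube_le (hn : 1 ≤ n) (σ : ℕ) : F.T' n σ * σ ^ (3 * n) ≤ 2 * n * (σ ^ (3 * n) * F.Θ n σ ^ n) := by
  have := F.T'_le n hn σ
  calc F.T' n σ * σ ^ (3 * n) ≤ (2 * n * F.Θ n σ ^ n) * σ ^ (3 * n) := Nat.mul_le_mul_right _ this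
    _ = _ := by ring

/-- **Bound for `NA₁`**: `NA₁ ≤ 4n(9+5cg)·N + (3 + 2hdeg + cg(2+hdeg))·D σ^{3n}`. [folklore] -/
theorem NA₁_le {σ : ℕ} (hσ : 1 ≤ σ) :
    F.NA₁ n dd hdeg cg σ ≤ 4 * n * (9 + 5 * cg) * (σ ^ (3 * n) * F.Θ n σ ^ n) +
      (3 + 2 * hdeg + cg * (2 + hdeg)) * (F.Dn n dd σ * σ ^ (3 * n)) := by
  rw [NA₁, S₀_add_one n hσ, ET, ← pow_mul, mul_comm n 3]
  set Q := σ ^ (3 * n) with hQ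
  set D := F.Dn n dd σ with hD
  set Tt := F.T n σ with hTt
  have hQ1 : 1 ≤ Q := Nat.one_le_pow _ _ hσ
  have hTQ : Tt * Q = 4 * n * (Q * F.Θ n σ ^ n) := F.T_mul_cube (n := n) σ
  -- expand and bound
  have e : (1 + cg * Q) * (2 * D + Tt * 3 + (D * hdeg + 2 * Tt)) + 2 * Tt + D + Q * (D * hdeg + 2 * Tt) =
      (3 + hdeg) * D + cg * (2 + hdeg) * (D * Q) + hdeg * (D * Q) + 7 * Tt + (5 * cg + 2) * (Tt * Q) := by ring
  rw [e]
  have h1 : (3 + hdeg) * D ≤ (3 + hdeg) * (D * Q) := Nat.mul_le_mul_left _ (Nat.le_mul_of_pos_right _ (by omega))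
  have h2 : 7 * Tt ≤ 7 * (Tt * Q) := Nat.mul_le_mul_left _ (Nat.le_mul_of_pos_right _ (by omega))
  rw [hTQ] at h2 ⊢
  nlinarith [h1, h2]

/-- **Bound for `dE`**: `dE ≤ 10n(1 + cg(nℓ+1)³)·N + (2+hdeg)(1 + cg(nℓ+1)³)·D σ^{3n}`. [folklore] -/
theorem dE_le (hn : 1 ≤ n) {σ : ℕ} (hσ : 1 ≤ σ) :
    F.dE n dd hdeg cg σ ≤ 10 * n * (1 + cg * (n * F.ℓ + 1) ^ 3) * (σ ^ (3 * n) * F.Θ n σ ^ n) +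
      (2 + hdeg) * (1 + cg * (n * F.ℓ + 1) ^ 3) * (F.Dn n dd σ * σ ^ (3 * n)) := by
  rw [dE, E']
  set Q := σ ^ (3 * n) with hQ
  set D := F.Dn n dd σ with hD
  set N := Q * F.Θ n σ ^ n with hN
  have hQ1 : 1 ≤ Q := Nat.one_le_pow _ _ hσ
  have hS := F.S₁_cube_le (n := n) hσ
  rw [← hQ] at hS
  have hT' := F.T'_mul_cube_le (n := n) hn σ
  rw [← hQ, ← hN] at hT'
  set c := (n * F.ℓ + 1) ^ 3 with hc
  -- `1 + cg (S₁+1)³ ≤ (1 + cg c) Q`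
  have hA : 1 + cg * (F.S₁ n σ + 1) ^ 3 ≤ (1 + cg * c) * Q := by nlinarith
  -- `E' = (2+hdeg) D + 5 T'`
  have e : 2 * D + F.T' n σ * 3 + (D * hdeg + 2 * F.T' n σ) = (2 + hdeg) * D + 5 * F.T' n σ := by ring
  rw [e]
  calc (1 + cg * (F.S₁ n σ + 1) ^ 3) * ((2 + hdeg) * D + 5 * F.T' n σ)
      ≤ ((1 + cg * c) * Q) * ((2 + hdeg) * D + 5 * F.T' n σ) := Nat.mul_le_mul_right _ hA
    _ = (2 + hdeg) * (1 + cg * c) * (D * Q) + 5 * (1 + cg * c) * (F.T' n σ * Q) := by ring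
    _ ≤ (2 + hdeg) * (1 + cg * c) * (D * Q) + 5 * (1 + cg * c) * (2 * n * N) :=
        Nat.add_le_add_left (Nat.mul_le_mul_left _ hT') _
    _ = 10 * n * (1 + cg * c) * N + (2 + hdeg) * (1 + cg * c) * (D * Q) := by ring

/-- **Bound for `L₁`**: `L₁ ≤ (4n + 3 + 4n(nℓ+1)³)·N + (1 + hdeg(nℓ+1)³)·D σ^{3n}`. [folklore] -/
theorem L₁_le (hn : 1 ≤ n) {σ : ℕ} (hσ : 1 ≤ σ) :
    F.L₁ n dd hdeg σ ≤ (4 * n + 3 + 4 * n * (n * F.ℓ + 1) ^ 3) * (σ ^ (3 * n) * F.Θ n σ ^ n) +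
      (1 + hdeg * (n * F.ℓ + 1) ^ 3) * (F.Dn n dd σ * σ ^ (3 * n)) := by
  rw [L₁, P₁]
  set Q := σ ^ (3 * n) with hQ
  set D := F.Dn n dd σ with hD
  set N := Q * F.Θ n σ ^ n with hN
  obtain ⟨hN1, -⟩ := F.unit_ge (n := n) hσ
  rw [← hQ, ← hN] at hN1
  have hQ1 : 1 ≤ Q := Nat.one_le_pow _ _ hσ
  have hS := F.S₁_cube_le (n := n) hσ
  rw [← hQ] at hS
  have hT' := F.T'_mul_cube_le (n := n) hn σ
  rw [← hQ, ← hN] at hT'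
  have hT'1 : F.T' n σ ≤ F.T' n σ * Q := Nat.le_mul_of_pos_right _ (by omega)
  set c := (n * F.ℓ + 1) ^ 3 with hc
  have h1 : 2 * F.T' n σ ≤ 4 * n * N := by nlinarith
  have h2 : 3 ≤ 3 * N := by nlinarith
  have h3 : D ≤ D * Q := Nat.le_mul_of_pos_right _ (by omega)
  have h4 : (F.S₁ n σ + 1) ^ 3 * (D * hdeg + 2 * F.T' n σ) ≤ c * Q * (D * hdeg + 2 * F.T' n σ) :=
    Nat.mul_le_mul_right _ hS
  have h5 : c * Q * (D * hdeg + 2 * F.T' n σ) = hdeg * c * (D * Q) + 2 * c * (F.T' n σ * Q) := by ring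
  have h6 : 2 * c * (F.T' n σ * Q) ≤ 2 * c * (2 * n * N) := Nat.mul_le_mul_left _ hT'
  nlinarith [h1, h2, h3, h4, h5, h6]

/-- **Bound for `Y`**: `Y ≤ (1 + (nℓ+1)³)·D σ^{3n}`. [folklore] -/
theorem Y_le {σ : ℕ} (hσ : 1 ≤ σ) : F.Y n dd σ ≤ (1 + (n * F.ℓ + 1) ^ 3) * (F.Dn n dd σ * σ ^ (3 * n)) := by
  rw [Y]
  have hQ1 : 1 ≤ σ ^ (3 * n) := Nat.one_le_pow _ _ hσ
  have hS := F.S₁_cube_le (n := n) hσ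
  nlinarith

/-- **Bound for the growth exponent**: `gE ≤ N + D σ^{3n}` once `(R'+1)²G² ≤ Θ`, `κ_D ≤ σ`, `dd < n`.
[folklore] -/
theorem gE_le (hn : 1 ≤ n) (hdd : dd < n) {σ : ℕ} (hσ : 1 ≤ σ) (hσκ : κD n dd ≤ σ)
    (hΘR : (F.R' n σ + 1) ^ 2 * F.G ^ 2 ≤ F.Θ n σ) :
    F.gE n dd σ ≤ σ ^ (3 * n) * F.Θ n σ ^ n + F.Dn n dd σ * σ ^ (3 * n) := by
  rw [gE, mul_add, mul_one, add_comm]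
  refine Nat.add_le_add ?_ (Nat.le_mul_of_pos_right _ (Nat.one_le_pow _ _ hσ))
  calc F.Dn n dd σ * ((F.R' n σ + 1) ^ 2 * F.G ^ 2) ≤ F.Dn n dd σ * F.Θ n σ := Nat.mul_le_mul_left _ hΘR
    _ = κD n dd * σ * (F.Θ n σ * F.Θ n σ ^ dd) := by rw [F.Dn_eq]; ring
    _ ≤ (σ * σ) * F.Θ n σ ^ n := by
        refine Nat.mul_le_mul (Nat.mul_le_mul_right _ hσκ) ?_
        rw [← pow_succ']; exact Nat.pow_le_pow_right (F.one_le_Θ n σ) (by omega)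
    _ ≤ σ ^ (3 * n) * F.Θ n σ ^ n := by
        refine Nat.mul_le_mul_right _ ?_
        calc σ * σ = σ ^ 2 := (sq σ).symm
          _ ≤ σ ^ (3 * n) := Nat.pow_le_pow_right hσ (by omega)

/-- **Bound for `ω·X₂`**: `ω X₂ ≤ N` once `18nh(na + E₀) ≤ σ` (`n, h ≥ 1`). [folklore] -/
theorem ωX₂_le (hn : 1 ≤ n) (hh : 1 ≤ h) {σ : ℕ} (hσ : 1 ≤ σ)
    (hσω : 18 * n * h * (n * F.a + F.E₀ n dd hdeg) ≤ σ) :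
    F.ω n dd hdeg σ * F.X₂ n h σ ≤ σ ^ (3 * n) * F.Θ n σ ^ n := by
  set A := F.Θ n σ ^ n with hA
  have hA1 : 1 ≤ A := F.one_le_Θ_pow n σ n
  have hT' := F.T'_le n hn σ
  rw [← hA] at hT'
  have hTt : F.T n σ = 4 * n * A := rfl
  have hσn : 1 ≤ σ ^ n := Nat.one_le_pow _ _ hσ
  -- `X₂ ≤ 18 n h A`
  have hX : F.X₂ n h σ ≤ 18 * n * h * A := by
    rw [X₂, L₂, hTt]
    have hh' : h - 1 ≤ h := Nat.sub_le h 1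
    have e0 : 2 * F.T' n σ + 3 * n ≤ 7 * n * A := by
      have e2 : 3 * n ≤ 3 * n * A := Nat.le_mul_of_pos_right _ (by omega)
      nlinarith [hT', e2]
    have e1 : (h - 1) * (2 * F.T' n σ + 3 * n) ≤ h * (7 * n * A) :=
      (Nat.mul_le_mul_right _ hh').trans (Nat.mul_le_mul_left h e0)
    have e3 : 7 * n * A ≤ 7 * n * h * A := by
      calc 7 * n * A = 7 * n * 1 * A := by ring
        _ ≤ 7 * n * h * A := by gcongr
    calc 2 * F.T' n σ + n + 2 * n + (h - 1) * (2 * F.T' n σ + 3 * n) + h * (4 * n * A)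
        ≤ 7 * n * A + h * (7 * n * A) + h * (4 * n * A) := by omega
      _ ≤ 7 * n * h * A + h * (7 * n * A) + h * (4 * n * A) := by omega
      _ = 18 * n * h * A := by ring
  -- `ω ≤ (na + E₀) σ^{2n}`
  have hω : F.ω n dd hdeg σ ≤ (n * F.a + F.E₀ n dd hdeg) * σ ^ (2 * n) := by
    rw [ω, add_mul]
    refine Nat.add_le_add le_rfl (Nat.mul_le_mul_left _ (Nat.pow_le_pow_right hσ (by omega)))
  calc F.ω n dd hdeg σ * F.X₂ n h σ ≤ ((n * F.a + F.E₀ n dd hdeg) * σ ^ (2 * n)) * (18 * n * h * A) :=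
        Nat.mul_le_mul hω hX
    _ = (18 * n * h * (n * F.a + F.E₀ n dd hdeg)) * σ ^ (2 * n) * A := by ring
    _ ≤ σ * σ ^ (2 * n) * A := by gcongr
    _ ≤ σ ^ (3 * n) * A := by
        refine Nat.mul_le_mul_right _ ?_
        rw [← pow_succ']
        exact Nat.pow_le_pow_right hσ (by omega)

/-- **The exponent inequality of the numerical condition along the family.** For `n ≥ 1`,
`dd < n`, `h ≥ 1`, `b ≥ b₀` and `σ`, `Θ` beyond the explicit thresholds
(`κ_D ≤ σ`, `18nh(na+E₀) ≤ σ`, `C_D κ_D σ ≤ Θ`, `(R'+1)²G² ≤ Θ`):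
`X₁ + ω·X₂ + Y < b·σ^{2n}·(T - T')(S₀+1)`. [cite: BakerWustholz2007, §6.8 (p. 119)] -/
theorem exponent_ineq (hn : 1 ≤ n) (hdd : dd < n) (hh : 1 ≤ h) (hb : F.b₀ n h cg ≤ F.b) {σ : ℕ} (hσ : 1 ≤ σ)
    (hσκ : κD n dd ≤ σ) (hσω : 18 * n * h * (n * F.a + F.E₀ n dd hdeg) ≤ σ)
    (hΘD : F.CD n h hdeg cg * κD n dd * σ ≤ F.Θ n σ) (hΘR : (F.R' n σ + 1) ^ 2 * F.G ^ 2 ≤ F.Θ n σ) :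
    F.X₁ n dd h hdeg cg σ + F.ω n dd hdeg σ * F.X₂ n h σ + F.Y n dd σ < F.b * σ ^ (2 * n) * F.Msave n σ := by
  set N := σ ^ (3 * n) * F.Θ n σ ^ n with hN
  set DQ := F.Dn n dd σ * σ ^ (3 * n) with hDQ
  obtain ⟨hN1, hAN⟩ := F.unit_ge (n := n) hσ
  rw [← hN] at hN1 hAN
  -- the pieces
  have t1 : 2 * F.T' n σ ≤ 4 * n * N := by
    calc 2 * F.T' n σ ≤ 2 * (2 * n * F.Θ n σ ^ n) := Nat.mul_le_mul_left _ (F.T'_le n hn σ)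
      _ = 4 * n * F.Θ n σ ^ n := by ring
      _ ≤ 4 * n * N := Nat.mul_le_mul_left _ hAN
  have t2 : 3 ≤ 3 * N := Nat.le_mul_of_pos_right 3 hN1
  have t3 := F.gE_le hn hdd hσ hσκ hΘR
  have t4 := F.dE_le (dd := dd) (hdeg := hdeg) (cg := cg) hn hσ
  have t5 := F.L₁_le (dd := dd) (hdeg := hdeg) hn hσ
  have t6 := F.NA₁_le (n := n) (dd := dd) (hdeg := hdeg) (cg := cg) hσ
  have t7 := F.ωX₂_le (h := h) (hdeg := hdeg) hn hh hσ hσω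
  have t8 := F.Y_le (n := n) (dd := dd) hσ
  rw [← hN] at t3 t4 t5 t6 t7
  rw [← hDQ] at t3 t4 t5 t6 t8
  have hh' : h - 1 ≤ h := Nat.sub_le h 1
  -- collect: `≤ CA · N + CD · DQ`
  set c := (n * F.ℓ + 1) ^ 3 with hc
  have e4 : h * F.dE n dd hdeg cg σ ≤ h * (10 * n * (1 + cg * c) * N + (2 + hdeg) * (1 + cg * c) * DQ) :=
    Nat.mul_le_mul_left h t4
  have e5 : (h - 1) * F.L₁ n dd hdeg σ ≤ h * ((4 * n + 3 + 4 * n * c) * N + (1 + hdeg * c) * DQ) :=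
    (Nat.mul_le_mul_right _ hh').trans (Nat.mul_le_mul_left h t5)
  have e6 : h * F.NA₁ n dd hdeg cg σ ≤ h * (4 * n * (9 + 5 * cg) * N + (3 + 2 * hdeg + cg * (2 + hdeg)) * DQ) :=
    Nat.mul_le_mul_left h t6
  have hsum : F.X₁ n dd h hdeg cg σ + F.ω n dd hdeg σ * F.X₂ n h σ + F.Y n dd σ ≤
      F.CA n h cg * N + F.CD n h hdeg cg * DQ := by
    calc F.X₁ n dd h hdeg cg σ + F.ω n dd hdeg σ * F.X₂ n h σ + F.Y n dd σ
        = 2 * F.T' n σ + 3 + F.gE n dd σ + h * F.dE n dd hdeg cg σ + (h - 1) * F.L₁ n dd hdeg σ +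
            h * F.NA₁ n dd hdeg cg σ + F.ω n dd hdeg σ * F.X₂ n h σ + F.Y n dd σ := rfl
      _ ≤ 4 * n * N + 3 * N + (N + DQ) + h * (10 * n * (1 + cg * c) * N + (2 + hdeg) * (1 + cg * c) * DQ) +
            h * ((4 * n + 3 + 4 * n * c) * N + (1 + hdeg * c) * DQ) +
            h * (4 * n * (9 + 5 * cg) * N + (3 + 2 * hdeg + cg * (2 + hdeg)) * DQ) + N + (1 + c) * DQ :=
          Nat.add_le_add (Nat.add_le_add (Nat.add_le_add (Nat.add_le_add (Nat.add_le_add (Nat.add_le_add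
            (Nat.add_le_add t1 t2) t3) e4) e5) e6) t7) t8
      _ = F.CA n h cg * N + F.CD n h hdeg cg * DQ := by rw [CA, CD, hc]; ring
  -- `CD · DQ ≤ N`
  have hD : F.CD n h hdeg cg * DQ ≤ N := F.Dn_cube_le hdd hΘD
  -- the saving: `σ^{2n} Msave ≥ 2 n N`
  have hM : 2 * n * N ≤ σ ^ (2 * n) * F.Msave n σ := by
    have := F.two_n_pow_le_T_sub n hn σ
    calc 2 * n * N = σ ^ (2 * n) * ((2 * n * F.Θ n σ ^ n) * σ ^ n) := by
          rw [hN, show 3 * n = 2 * n + n by ring, pow_add]; ring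
      _ ≤ σ ^ (2 * n) * ((F.T n σ - F.T' n σ) * σ ^ n) := Nat.mul_le_mul_left _ (Nat.mul_le_mul_right _ this)
      _ = σ ^ (2 * n) * F.Msave n σ := by rw [Msave, S₀_add_one n hσ]
  have hb1 : F.CA n h cg + 2 ≤ F.b := hb
  have hlt : (F.CA n h cg + 1) * N < F.b * (2 * n * N) := by
    have h1 : (F.CA n h cg + 1) * N < (F.CA n h cg + 2) * N :=
      Nat.mul_lt_mul_of_pos_right (Nat.lt_succ_self _) hN1
    have h2 : (F.CA n h cg + 2) * N ≤ F.b * N := Nat.mul_le_mul_right _ hb1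
    have h3 : F.b * N ≤ F.b * (2 * n * N) :=
      Nat.mul_le_mul_left _ (Nat.le_mul_of_pos_left N (by omega))
    exact lt_of_lt_of_le h1 (h2.trans h3)
  calc F.X₁ n dd h hdeg cg σ + F.ω n dd hdeg σ * F.X₂ n h σ + F.Y n dd σ
      ≤ F.CA n h cg * N + F.CD n h hdeg cg * DQ := hsum
    _ ≤ F.CA n h cg * N + N := Nat.add_le_add_left hD _
    _ = (F.CA n h cg + 1) * N := by ring
    _ < F.b * (2 * n * N) := hlt
    _ ≤ F.b * (σ ^ (2 * n) * F.Msave n σ) := Nat.mul_le_mul_left _ hM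
    _ = F.b * σ ^ (2 * n) * F.Msave n σ := by ring

end Exponents

end FamilyG

end BakerDataG

end Std

end GaGmE

end Literature.NumberTheory.Transcendental

end

/-!
## Part III — the numerical condition at a general algebraic point holds along the exponential family

`NumCondFamily.lean` for the general-point data `BakerDataG` and the exponential family `FamilyG`:
the linear sizes are dominated by `W = G^{ω}` (`sizes_le_W`), the thresholds on `Θ` follow from
thresholds on `σ` (`ΘR_le`, `ΘD_le`, `ΘK_lt`), `NumCond₂` holds along the family for every
coefficient vector within the Siegel bound (`numCond₂_familyG`: the envelopes of `EnvelopesG`, all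
in the single base `G ≥ bigConst`, and `FamilyG.exponent_ineq`), and finally
**`admissibleParamsG_of_lt` — `AdmissibleParamsG B dd c` holds for every general-point Baker datum
with `dd < n` and every `c > 0`.** Everything is proved; no named facts.

## References

* A. Baker, G. Wüstholz, *Logarithmic Forms and Diophantine Geometry*, CUP 2007, §6.8 (p. 119).
-/

noncomputable section

open Complex MvPolynomial Finset NumberField
open scoped PeriodPair

namespace Literature.NumberTheory.Transcendental

namespace GaGmE

namespace Std

namespace BakerDataG

open BakerData (UIdx νOf νOf_apply νOf_injective degree_νOf_le card_UIdx saving_le)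
open BakerData.Family (κD S₀ S₀_add_one)

namespace FamilyG

variable (F : FamilyG) {n dd : ℕ}

/-- `x ≤ G^x` for `G ≥ 2`. [folklore] -/
theorem le_pow_self (x : ℕ) : x ≤ F.G ^ x :=
  (Nat.lt_two_pow_self).le.trans (Nat.pow_le_pow_left F.hG x)

/-- The linear sizes are dominated by `W = G^{ω}`, `ω = naσ^{2n} + E₀σ^n`. [folklore] -/
theorem sizes_le_W (hn : 1 ≤ n) (hdd : dd < n) (hdeg : ℕ) {σ : ℕ} (hσ : 1 ≤ σ) :
    F.D' n dd σ + 1 ≤ F.G ^ F.ω n dd hdeg σ ∧ F.T' n σ ≤ F.G ^ F.ω n dd hdeg σ ∧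
    F.S₁ n σ + 1 ≤ F.G ^ F.ω n dd hdeg σ ∧ S₀ n σ + 1 ≤ F.G ^ F.ω n dd hdeg σ ∧
    n * F.D' n dd σ * hdeg + 2 * F.T n σ + 1 ≤ F.G ^ F.ω n dd hdeg σ ∧
    n * F.D' n dd σ * hdeg + 2 * F.T' n σ ≤ F.G ^ F.ω n dd hdeg σ := by
  have hG1 : 1 ≤ F.G := by have := F.hG; omega
  have hσn : 1 ≤ σ ^ n := Nat.one_le_pow _ _ hσ
  set A := F.Θ n σ ^ n with hA
  have hA1 : 1 ≤ A := F.one_le_Θ_pow n σ n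
  -- `Θ^n = G^{naσ^{2n}}` and `Θ^{dd} ≤ Θ^n`
  have hAeq : A = F.G ^ (n * F.a * σ ^ (2 * n)) := by
    rw [hA, Θ, ← pow_mul]; congr 1; ring
  have hdd' : F.Θ n σ ^ dd ≤ A := Nat.pow_le_pow_right (F.one_le_Θ n σ) hdd.le
  -- the common shape: `x·A ≤ G^ω` whenever `x ≤ E₀ σ^n`
  have key : ∀ x : ℕ, x ≤ F.E₀ n dd hdeg * σ ^ n → x * A ≤ F.G ^ F.ω n dd hdeg σ := by
    intro x hx
    rw [ω, pow_add, hAeq, mul_comm]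
    refine Nat.mul_le_mul_left _ ((F.le_pow_self x).trans (Nat.pow_le_pow_right hG1 hx))
  set E := F.E₀ n dd hdeg with hEdef
  have hE₀ : E = hdeg * κD n dd + 8 * n + n * F.ℓ + κD n dd + 3 := rfl
  -- `u σ + v ≤ E σ^n` whenever `u + v ≤ E`
  have hσσn : σ ≤ σ ^ n := by
    calc σ = σ ^ 1 := (pow_one σ).symm
      _ ≤ σ ^ n := Nat.pow_le_pow_right hσ hn
  have lin : ∀ u v : ℕ, u + v ≤ E → u * σ + v ≤ E * σ ^ n := by
    intro u v huv
    calc u * σ + v ≤ u * σ ^ n + v * σ ^ n :=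
          Nat.add_le_add (Nat.mul_le_mul_left _ hσσn) (Nat.le_mul_of_pos_right _ (by omega))
      _ = (u + v) * σ ^ n := by ring
      _ ≤ E * σ ^ n := Nat.mul_le_mul_right _ huv
  have lin' : ∀ u v : ℕ, u + v ≤ E → u * σ ^ n + v ≤ E * σ ^ n := by
    intro u v huv
    calc u * σ ^ n + v ≤ u * σ ^ n + v * σ ^ n := Nat.add_le_add_left (Nat.le_mul_of_pos_right _ (by omega)) _
      _ = (u + v) * σ ^ n := by ring
      _ ≤ E * σ ^ n := Nat.mul_le_mul_right _ huv
  -- `D ≤ κ σ A`, `D' ≤ D`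
  have hD : n * F.D' n dd σ ≤ κD n dd * σ * A := by
    rw [show n * F.D' n dd σ = F.Dn n dd σ from rfl, F.Dn_eq]; exact Nat.mul_le_mul_left _ hdd'
  have hD' : F.D' n dd σ ≤ κD n dd * σ * A := (Nat.le_mul_of_pos_left _ (by omega)).trans hD
  have hT : F.T n σ = 4 * n * A := rfl
  have hT' : F.T' n σ ≤ 2 * n * A := F.T'_le n hn σ
  have hS := F.S₁_add_one_le (n := n) hσ
  have hS₀ : S₀ n σ + 1 = σ ^ n := S₀_add_one n hσ
  refine ⟨?_, ?_, ?_, ?_, ?_, ?_⟩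
  · have h1 : F.D' n dd σ + 1 ≤ (κD n dd * σ + 1) * A := by
      calc F.D' n dd σ + 1 ≤ κD n dd * σ * A + A := Nat.add_le_add hD' hA1
        _ = (κD n dd * σ + 1) * A := by ring
    exact h1.trans (key _ (lin _ _ (by rw [hE₀]; omega)))
  · exact hT'.trans (key _ ((lin 0 (2 * n) (by rw [hE₀]; omega)).trans' (by simp)))
  · have h1 : F.S₁ n σ + 1 ≤ ((n * F.ℓ + 1) * σ ^ n) * A := hS.trans (Nat.le_mul_of_pos_right _ (by omega))
    exact h1.trans (key _ ((lin' (n * F.ℓ + 1) 0 (by rw [hE₀]; omega)).trans' (by simp)))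
  · have h1 : S₀ n σ + 1 ≤ (1 * σ ^ n) * A := by
      rw [hS₀, one_mul]; exact Nat.le_mul_of_pos_right _ (by omega)
    exact h1.trans (key _ ((lin' 1 0 (by rw [hE₀]; omega)).trans' (by simp)))
  · have h1 : n * F.D' n dd σ * hdeg + 2 * F.T n σ + 1 ≤ (hdeg * κD n dd * σ + (8 * n + 1)) * A := by
      rw [hT]
      calc n * F.D' n dd σ * hdeg + 2 * (4 * n * A) + 1 ≤ (κD n dd * σ * A) * hdeg + 2 * (4 * n * A) + A :=
            Nat.add_le_add (Nat.add_le_add_right (Nat.mul_le_mul_right _ hD) _) hA1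
        _ = (hdeg * κD n dd * σ + (8 * n + 1)) * A := by ring
    exact h1.trans (key _ (lin _ _ (by rw [hE₀]; nlinarith)))
  · have h1 : n * F.D' n dd σ * hdeg + 2 * F.T' n σ ≤ (hdeg * κD n dd * σ + 4 * n) * A := by
      calc n * F.D' n dd σ * hdeg + 2 * F.T' n σ ≤ (κD n dd * σ * A) * hdeg + 2 * (2 * n * A) :=
            Nat.add_le_add (Nat.mul_le_mul_right _ hD) (Nat.mul_le_mul_left _ hT')
        _ = (hdeg * κD n dd * σ + 4 * n) * A := by ring
    exact h1.trans (key _ (lin _ _ (by rw [hE₀]; nlinarith)))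

/-- **The growth threshold**: `(R'+1)²G² ≤ Θ` once `a ≥ 9(nℓ+1)² + 2b + 2`. [folklore] -/
theorem ΘR_le {σ : ℕ} (hσ : 1 ≤ σ) (ha : 9 * (n * F.ℓ + 1) ^ 2 + 2 * F.b + 2 ≤ F.a) :
    (F.R' n σ + 1) ^ 2 * F.G ^ 2 ≤ F.Θ n σ := by
  have hG1 : 1 ≤ F.G := by have := F.hG; omega
  set P := σ ^ (2 * n) with hP
  have hP1 : 1 ≤ P := Nat.one_le_pow _ _ hσ
  set E := F.G ^ (F.b * P) with hE
  have hE1 : 1 ≤ E := Nat.one_le_pow _ _ hG1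
  have hσn : 1 ≤ σ ^ n := Nat.one_le_pow _ _ hσ
  have hR : F.R' n σ + 1 ≤ 3 * (n * F.ℓ + 1) * σ ^ n * E := by
    have h1 : 1 ≤ (n * F.ℓ + 1) * σ ^ n * E :=
      Nat.one_le_iff_ne_zero.mpr (Nat.mul_ne_zero (Nat.mul_ne_zero (by omega) (by omega)) (by omega))
    have e : F.R' n σ = 2 * ((n * F.ℓ + 1) * σ ^ n * E) := by unfold R'; rw [← hP, ← hE]; ring
    have e' : 3 * (n * F.ℓ + 1) * σ ^ n * E = 3 * ((n * F.ℓ + 1) * σ ^ n * E) := by ring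
    rw [e, e']; omega
  have hsq : (σ ^ n) ^ 2 = P := by rw [← pow_mul, mul_comm, hP]
  have h1 : (F.R' n σ + 1) ^ 2 * F.G ^ 2 ≤ (9 * (n * F.ℓ + 1) ^ 2 * P) * (E ^ 2 * F.G ^ 2) := by
    calc (F.R' n σ + 1) ^ 2 * F.G ^ 2 ≤ (3 * (n * F.ℓ + 1) * σ ^ n * E) ^ 2 * F.G ^ 2 :=
          Nat.mul_le_mul_right _ (Nat.pow_le_pow_left hR 2)
      _ = (9 * (n * F.ℓ + 1) ^ 2 * P) * (E ^ 2 * F.G ^ 2) := by rw [← hsq]; ring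
  have h2 : 9 * (n * F.ℓ + 1) ^ 2 * P ≤ F.G ^ (9 * (n * F.ℓ + 1) ^ 2 * P) := F.le_pow_self _
  have h3 : E ^ 2 * F.G ^ 2 = F.G ^ (2 * F.b * P + 2) := by rw [hE, ← pow_mul, ← pow_add]; congr 1; ring
  calc (F.R' n σ + 1) ^ 2 * F.G ^ 2 ≤ (9 * (n * F.ℓ + 1) ^ 2 * P) * (E ^ 2 * F.G ^ 2) := h1
    _ ≤ F.G ^ (9 * (n * F.ℓ + 1) ^ 2 * P) * F.G ^ (2 * F.b * P + 2) := by rw [h3]; exact Nat.mul_le_mul_right _ h2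
    _ = F.G ^ (9 * (n * F.ℓ + 1) ^ 2 * P + (2 * F.b * P + 2)) := (pow_add _ _ _).symm
    _ ≤ F.G ^ (F.a * P) := Nat.pow_le_pow_right hG1 (by nlinarith)
    _ = F.Θ n σ := by rw [Θ, hP]

/-- `σ^{2n} < Θ` and `σ·σ ≤ σ^{2n}` (`n ≥ 1`). [folklore] -/
theorem pow_two_n_lt_Θ (hn : 1 ≤ n) (σ : ℕ) : σ ^ (2 * n) < F.Θ n σ ∧ σ * σ ≤ σ ^ (2 * n) := by
  have hG1 : 1 ≤ F.G := by have := F.hG; omega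
  constructor
  · calc σ ^ (2 * n) < 2 ^ (σ ^ (2 * n)) := Nat.lt_two_pow_self
      _ ≤ F.G ^ (σ ^ (2 * n)) := Nat.pow_le_pow_left F.hG _
      _ ≤ F.G ^ (F.a * σ ^ (2 * n)) := Nat.pow_le_pow_right hG1 (Nat.le_mul_of_pos_left _ F.ha)
      _ = F.Θ n σ := rfl
  · rcases Nat.eq_zero_or_pos σ with rfl | hσ
    · simp
    · calc σ * σ = σ ^ 2 := (sq σ).symm
        _ ≤ σ ^ (2 * n) := Nat.pow_le_pow_right hσ (by omega)

/-- **The `D`-threshold**: `K·κ_D·σ ≤ Θ` once `K·κ_D ≤ σ` (`n ≥ 1`). [folklore] -/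
theorem ΘD_le (hn : 1 ≤ n) {K σ : ℕ} (hσK : K * κD n dd ≤ σ) : K * κD n dd * σ ≤ F.Θ n σ := by
  obtain ⟨h1, h2⟩ := F.pow_two_n_lt_Θ hn σ
  calc K * κD n dd * σ ≤ σ * σ := Nat.mul_le_mul_right _ hσK
    _ ≤ σ ^ (2 * n) := h2
    _ ≤ F.Θ n σ := h1.le

/-- **The zero-estimate threshold**: `K·σ^n < Θ` once `K ≤ σ` (`n ≥ 1`, real `K ≥ 0`). [folklore] -/
theorem ΘK_lt (hn : 1 ≤ n) {K : ℝ} {σ : ℕ} (hσ : 1 ≤ σ) (hσK : K ≤ σ) :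
    K * (σ : ℝ) ^ n < F.Θ n σ := by
  obtain ⟨h1, -⟩ := F.pow_two_n_lt_Θ hn σ
  have hσ1 : (1 : ℝ) ≤ σ := by exact_mod_cast hσ
  have hσn : (σ : ℝ) ≤ (σ : ℝ) ^ n := by
    calc (σ : ℝ) = (σ : ℝ) ^ 1 := (pow_one _).symm
      _ ≤ (σ : ℝ) ^ n := pow_le_pow_right₀ hσ1 hn
  have h1' : ((σ ^ (2 * n) : ℕ) : ℝ) < (F.Θ n σ : ℝ) := by exact_mod_cast h1
  push_cast at h1'
  calc K * (σ : ℝ) ^ n ≤ (σ : ℝ) * (σ : ℝ) ^ n := mul_le_mul_of_nonneg_right hσK (by positivity)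
    _ ≤ (σ : ℝ) ^ n * (σ : ℝ) ^ n := mul_le_mul_of_nonneg_right hσn (by positivity)
    _ = (σ : ℝ) ^ (2 * n) := by rw [← pow_add]; ring_nf
    _ < F.Θ n σ := h1'

end FamilyG

variable {β γ δ : Type} [Fintype β] [Fintype γ] [Fintype δ] [DecidableEq γ]
variable [DecidableEq β] [DecidableEq δ] (B : BakerDataG β γ δ)

/-- **`NumCond₂` holds along the exponential family** (for `σ` beyond explicit thresholds), for every
coefficient vector within the Siegel house bound. Hypotheses: `n ≥ 1`, `dd < n`,
`b ≥ b₀(n, h, #Gen, ℓ)`, `a ≥ 9(nℓ+1)² + 2b + 2`, the base `G ≥ bigConst`, and the thresholds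
`κ_D ≤ σ`, `18nh(na + E₀) ≤ σ`, `C_D κ_D ≤ σ`. [cite: BakerWustholz2007, §6.8 (p. 119)] -/
theorem numCond₂_familyG (F : FamilyG) {n : ℕ} (hn' : Fintype.card (β ⊕ (γ ⊕ δ)) = n) (hn : 1 ≤ n)
    (hdd : B.dd < n) (hb : F.b₀ n B.gens.h (Fintype.card (Gen β γ δ)) ≤ F.b)
    (ha : 9 * (n * F.ℓ + 1) ^ 2 + 2 * F.b + 2 ≤ F.a) (hGG : B.bigConst ≤ F.G) {σ : ℕ} (hσ : 1 ≤ σ)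
    (hσκ : κD n B.dd ≤ σ) (hσω : 18 * n * B.gens.h * (n * F.a + F.E₀ n B.dd B.hdeg) ≤ σ)
    (hσD : F.CD n B.gens.h B.hdeg (Fintype.card (Gen β γ δ)) * κD n B.dd ≤ σ)
    {ξ : UIdx β γ δ (F.D' n B.dd σ) → 𝓞 B.K}
    (hξ : ∀ u, house ((ξ u : 𝓞 B.K) : B.K) ≤ B.siegelHouseBound (F.D' n B.dd σ) (F.T n σ) (S₀ n σ)) :
    B.NumCond₂ ξ (F.T n σ) (S₀ n σ) (F.S₁ n σ) (F.T' n σ) (F.R n σ) := by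
  -- basic facts about the base
  have hG2 := B.bigConst_spec.1
  have hG1 := B.one_le_bigConst
  set Gr : ℝ := (F.G : ℝ) with hGr
  have hGr2 : (2 : ℝ) ≤ Gr := by rw [hGr]; exact_mod_cast F.hG
  have hGr1 : (1 : ℝ) < Gr := by linarith
  have hGrG : B.bigConst ≤ Gr := hGG
  have h1 : 1 ≤ B.gens.h := B.gens.one_le_h
  set cg := Fintype.card (Gen β γ δ) with hcg
  -- the sizes and `W = Gr^ω`
  set ωσ := F.ω n B.dd B.hdeg σ with hωσ
  set W : ℝ := Gr ^ ωσ with hW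
  have hW1 : (1 : ℝ) ≤ W := one_le_pow₀ hGr1.le
  obtain ⟨sD, sT', sS₁, sS₀, sT, sP⟩ := F.sizes_le_W hn hdd B.hdeg hσ
  have castW : ∀ {m : ℕ}, m ≤ F.G ^ ωσ → (m : ℝ) ≤ W := fun hm => by
    rw [hW, hGr]; exact_mod_cast hm
  have hWD : (F.D' n B.dd σ : ℝ) + 1 ≤ W := by have := castW sD; push_cast at this; exact this
  have hWT' : (F.T' n σ : ℝ) ≤ W := castW sT'
  have hWS₁ : (F.S₁ n σ : ℝ) + 1 ≤ W := by have := castW sS₁; push_cast at this; exact this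
  have hWT : ((Fintype.card (β ⊕ (γ ⊕ δ)) * F.D' n B.dd σ * B.hdeg : ℕ) : ℝ) + 2 * (F.T n σ) + 1 ≤ W := by
    rw [hn']; have := castW sT; push_cast at this ⊢; linarith
  have hWP : ((Fintype.card (β ⊕ (γ ⊕ δ)) * F.D' n B.dd σ * B.hdeg : ℕ) : ℝ) + 2 * (F.T' n σ) ≤ W := by
    rw [hn']; have := castW sP; push_cast at this ⊢; linarith
  have hqp : 2 * ((S₀ n σ + 1) * F.T n σ ^ B.dd) ≤ (F.D' n B.dd σ + 1) ^ Fintype.card (β ⊕ (γ ⊕ δ)) := by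
    rw [hn']; exact F.two_p_le_q n B.dd hn hσ
  have hp : 0 < (S₀ n σ + 1) * F.T n σ ^ B.dd := Nat.mul_pos (Nat.succ_pos _) (pow_pos (F.T_pos n hn σ) _)
  -- `R`, `θ`
  obtain ⟨hR0, hR2⟩ := F.R_bounds n hn hσ
  have hRR' := F.R_le_R' (n := n) hσ
  set θ : ℝ := (Gr ^ (F.b * σ ^ (2 * n)))⁻¹ with hθ
  have hθ1 : θ ≤ 1 := inv_le_one_of_one_le₀ (one_le_pow₀ hGr1.le)
  have hθeq : 2 * ((F.S₁ n σ : ℝ) + S₀ n σ) / F.R n σ ≤ θ := by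
    have hRdef : F.R n σ = Gr ^ (F.b * σ ^ (2 * n)) * (2 * ((F.S₁ n σ : ℝ) + S₀ n σ)) := by
      unfold FamilyG.R FamilyG.S₁; push_cast; rw [hGr]
    have hsum : (0 : ℝ) < 2 * ((F.S₁ n σ : ℝ) + S₀ n σ) := by
      rw [hRdef] at hR0
      have hbpos : (0 : ℝ) < Gr ^ (F.b * σ ^ (2 * n)) := by positivity
      exact (pos_iff_pos_of_mul_pos hR0).mp hbpos
    rw [hRdef, hθ, div_le_iff₀ (by positivity)]
    rw [show (Gr ^ (F.b * σ ^ (2 * n)))⁻¹ * (Gr ^ (F.b * σ ^ (2 * n)) * (2 * ((F.S₁ n σ : ℝ) + S₀ n σ))) =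
      2 * ((F.S₁ n σ : ℝ) + S₀ n σ) from by field_simp]
  intro s hs k hk
  have hk' : k ≤ F.T' n σ := hk.le
  -- the envelopes
  have e1 := B.orderLoss_le hk' hW1 hWT'
  have eU : (Fintype.card (UIdx β γ δ (F.D' n B.dd σ)) : ℝ) ≤ W ^ n := by
    rw [card_UIdx, hn']; push_cast; exact pow_le_pow_left₀ (by positivity) hWD n
  have e3 := B.houseXi_le ξ hξ hW1 hWD hqp hp
  have eA := B.houseBound_le (F.D' n B.dd σ) (F.T n σ) (S₀ n σ) hW1 hWT
  have e4 := B.growth_le (Fintype.card (β ⊕ (γ ⊕ δ)) * F.D' n B.dd σ) hR0.le hRR' hGG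
  have e5 := saving_le (T := F.T n σ) hR0 hθeq hθ1 hs hk'
  have e6 := B.dAt_pow_le (D := Fintype.card (β ⊕ (γ ⊕ δ)) * F.D' n B.dd σ) hs hk'
  have e7 := B.lineValBound_le ξ hξ hW1 hWD hqp hp hWT' hWP hs hk'
  -- rename `card` to `n` in the envelopes and in the goal
  rw [hn'] at e3 eA e4 e6 e7
  rw [hn']
  rw [← hcg] at eA e6
  -- identify the exponents with the `FamilyG` names
  have iET : B.expE (n * F.D' n B.dd σ) (F.T n σ) = F.ET n B.dd B.hdeg σ := rfl
  have iE' : B.expE (n * F.D' n B.dd σ) (F.T' n σ) = F.E' n B.dd B.hdeg σ := rfl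
  rw [iET] at eA
  rw [iE'] at e6
  -- nonnegativity
  have hG0 : (0 : ℝ) ≤ B.bigConst := by linarith
  have hWr0 : (0 : ℝ) ≤ W := by linarith
  have hθ0 : (0 : ℝ) ≤ θ := by rw [hθ]; positivity
  have hA1 := B.one_le_houseBound (F.D' n B.dd σ) (F.T n σ) (S₀ n σ)
  have hA0 : (0 : ℝ) ≤ B.houseBound (F.D' n B.dd σ) (F.T n σ) (S₀ n σ) := zero_le_one.trans hA1
  -- substitute the house bound into `e3`, `e7`
  set EA : ℝ := B.bigConst ^ ((1 + cg * (S₀ n σ + 1) ^ 3) * F.ET n B.dd B.hdeg σ + 2 * F.T n σ + n * F.D' n B.dd σ +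
      (S₀ n σ + 1) ^ 3 * (n * F.D' n B.dd σ * B.hdeg + 2 * F.T n σ)) * W ^ (F.T n σ) with hEA
  have hEA0 : 0 ≤ EA := by rw [hEA]; positivity
  have e3' : B.houseXi ξ ≤ B.bigConst ^ 3 * W ^ (2 * n) * EA :=
    e3.trans (mul_le_mul_of_nonneg_left eA (by positivity))
  have e7' : B.lineValBound ξ s k ≤
      B.bigConst ^ (2 * F.T' n σ + 3 + n * F.D' n B.dd σ + (F.S₁ n σ + 1) ^ 3 * (n * F.D' n B.dd σ * B.hdeg + 2 * F.T' n σ)) *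
        W ^ (2 * F.T' n σ + 3 * n) * EA :=
    e7.trans (mul_le_mul_of_nonneg_left eA (by positivity))
  -- nonnegativity of the true factors
  have nU : (0 : ℝ) ≤ (Fintype.card (UIdx β γ δ (F.D' n B.dd σ)) : ℝ) := Nat.cast_nonneg _
  have nH : (0 : ℝ) ≤ B.houseXi ξ := zero_le_one.trans (B.one_le_houseXi ξ)
  have nG : (0 : ℝ) ≤ Real.exp (thetaGrowthC (β := β) B.L B.κM * (1 + (F.R n σ * ‖B.v‖ + 1) ^ 2)) ^ (n * F.D' n B.dd σ) :=
    pow_nonneg (Real.exp_nonneg _) _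
  have nS : (0 : ℝ) ≤ (2 * ((s : ℝ) + S₀ n σ) / F.R n σ) ^ ((F.T n σ - k) * (S₀ n σ + 1)) := by positivity
  have nL : (0 : ℝ) ≤ B.lineValBound ξ s k := B.lineValBound_nonneg ξ s k
  -- block 2: `#U · H_ξ · growth`
  have b2 : (Fintype.card (UIdx β γ δ (F.D' n B.dd σ)) : ℝ) * B.houseXi ξ *
        Real.exp (thetaGrowthC (β := β) B.L B.κM * (1 + (F.R n σ * ‖B.v‖ + 1) ^ 2)) ^ (n * F.D' n B.dd σ) ≤
      W ^ n * (B.bigConst ^ 3 * W ^ (2 * n) * EA) * B.bigConst ^ (n * F.D' n B.dd σ * (1 + (F.R' n σ + 1) ^ 2 * F.G ^ 2)) :=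
    mul_le_mul (mul_le_mul eU e3' nH (by positivity)) e4 nG (by positivity)
  -- block 4: the Liouville factors
  have b4 : |(B.dAt s : ℝ)| ^ B.expE (n * F.D' n B.dd σ) k *
        (|(B.dAt s : ℝ)| ^ B.expE (n * F.D' n B.dd σ) k * B.lineValBound ξ s k) ^ (B.gens.h - 1) ≤
      B.bigConst ^ ((1 + cg * (F.S₁ n σ + 1) ^ 3) * F.E' n B.dd B.hdeg σ) *
        (B.bigConst ^ ((1 + cg * (F.S₁ n σ + 1) ^ 3) * F.E' n B.dd B.hdeg σ) *
          (B.bigConst ^ (2 * F.T' n σ + 3 + n * F.D' n B.dd σ + (F.S₁ n σ + 1) ^ 3 * (n * F.D' n B.dd σ * B.hdeg + 2 * F.T' n σ)) *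
            W ^ (2 * F.T' n σ + 3 * n) * EA)) ^ (B.gens.h - 1) :=
    mul_le_mul e6 (pow_le_pow_left₀ (by positivity) (mul_le_mul e6 e7' nL (by positivity)) _) (by positivity)
      (by positivity)
  -- the whole left-hand side
  have hLHS := mul_le_mul (mul_le_mul (mul_le_mul e1 b2 (by positivity) (by positivity)) e5 nS (by positivity))
    b4 (by positivity) (by positivity)
  refine lt_of_le_of_lt hLHS ?_
  -- collect the exponents
  obtain ⟨h₁, hh₁⟩ : ∃ h₁, B.gens.h = h₁ + 1 := ⟨B.gens.h - 1, by omega⟩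
  have hΘD : F.CD n B.gens.h B.hdeg cg * κD n B.dd * σ ≤ F.Θ n σ := F.ΘD_le hn hσD
  have hΘR : (F.R' n σ + 1) ^ 2 * F.G ^ 2 ≤ F.Θ n σ := F.ΘR_le hσ ha
  have hX := F.exponent_ineq (n := n) (dd := B.dd) (h := B.gens.h) (hdeg := B.hdeg) (cg := cg)
    hn hdd h1 hb hσ hσκ hσω hΘD hΘR
  have key : B.bigConst ^ (F.X₁ n B.dd B.gens.h B.hdeg cg σ) * W ^ (F.X₂ n B.gens.h σ) * θ ^ (F.Msave n σ) <
      (B.thetaLowc * Real.exp (-(B.thetaLowC * ((s : ℝ) + 1) ^ 3))) ^ (n * F.D' n B.dd σ) := by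
    -- right-hand side from below
    have hY : n * F.D' n B.dd σ * (1 + (s + 1) ^ 3) ≤ F.Y n B.dd σ := by
      unfold FamilyG.Y FamilyG.Dn
      exact Nat.mul_le_mul_left _ (Nat.add_le_add_left (Nat.pow_le_pow_left (by omega) 3) 1)
    have hR := B.rhs_ge (n * F.D' n B.dd σ) s
    have hR' : (Gr ^ F.Y n B.dd σ)⁻¹ ≤ (B.thetaLowc * Real.exp (-(B.thetaLowC * ((s : ℝ) + 1) ^ 3))) ^ (n * F.D' n B.dd σ) := by
      refine le_trans ?_ hR
      rw [inv_le_inv₀ (by positivity) (by positivity)]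
      calc B.bigConst ^ (n * F.D' n B.dd σ * (1 + (s + 1) ^ 3)) ≤ Gr ^ (n * F.D' n B.dd σ * (1 + (s + 1) ^ 3)) :=
            pow_le_pow_left₀ hG0 hGrG _
        _ ≤ Gr ^ F.Y n B.dd σ := pow_le_pow_right₀ hGr1.le hY
    refine lt_of_lt_of_le ?_ hR'
    -- left-hand side from above, as a single power of `Gr`
    have hGX : B.bigConst ^ (F.X₁ n B.dd B.gens.h B.hdeg cg σ) ≤ Gr ^ (F.X₁ n B.dd B.gens.h B.hdeg cg σ) :=
      pow_le_pow_left₀ hG0 hGrG _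
    have hpos : (0 : ℝ) < Gr ^ (F.b * σ ^ (2 * n) * F.Msave n σ) := by positivity
    have hposY : (0 : ℝ) < Gr ^ F.Y n B.dd σ := by positivity
    calc B.bigConst ^ (F.X₁ n B.dd B.gens.h B.hdeg cg σ) * W ^ (F.X₂ n B.gens.h σ) * θ ^ (F.Msave n σ)
        ≤ Gr ^ (F.X₁ n B.dd B.gens.h B.hdeg cg σ) * W ^ (F.X₂ n B.gens.h σ) * θ ^ (F.Msave n σ) :=
          mul_le_mul_of_nonneg_right (mul_le_mul_of_nonneg_right hGX (by positivity)) (by positivity)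
      _ = Gr ^ (F.X₁ n B.dd B.gens.h B.hdeg cg σ + ωσ * F.X₂ n B.gens.h σ) *
          (Gr ^ (F.b * σ ^ (2 * n) * F.Msave n σ))⁻¹ := by
          rw [hW, hθ, inv_pow, ← pow_mul, ← pow_mul, pow_add]
      _ < (Gr ^ F.Y n B.dd σ)⁻¹ := by
          have hmain : Gr ^ (F.X₁ n B.dd B.gens.h B.hdeg cg σ + ωσ * F.X₂ n B.gens.h σ) * Gr ^ F.Y n B.dd σ <
              Gr ^ (F.b * σ ^ (2 * n) * F.Msave n σ) := by
            rw [← pow_add]; exact pow_lt_pow_right₀ hGr1 hX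
          rw [inv_eq_one_div (Gr ^ F.Y n B.dd σ), lt_div_iff₀ hposY, mul_assoc,
            mul_comm ((Gr ^ (F.b * σ ^ (2 * n) * F.Msave n σ))⁻¹), ← mul_assoc, ← div_eq_mul_inv, div_lt_one hpos]
          exact hmain
  refine lt_of_eq_of_lt ?_ key
  rw [hEA]
  unfold FamilyG.X₁ FamilyG.X₂ FamilyG.Msave FamilyG.NA₁ FamilyG.L₁ FamilyG.L₂ FamilyG.P₁ FamilyG.dE FamilyG.gE FamilyG.Dn
  rw [hh₁, Nat.add_sub_cancel]
  ring

/-! ### `AdmissibleParamsG` discharged -/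

/-- **`AdmissibleParamsG B dd c` holds for every general-point Baker datum with `dd < n` and every
`c > 0`.** The parameters are those of the exponential family with `ℓ = ⌈c κ^n n!⌉ + 1`,
`b = b₀`, `a = 9(nℓ+1)² + 2b + 2`, base `G = ⌈bigConst⌉`, and `σ` the sum of all thresholds.
[cite: BakerWustholz2007, §6.8 (p. 119)] -/
theorem admissibleParamsG_of_lt (hdd : B.dd < Fintype.card (β ⊕ (γ ⊕ δ))) {c : ℝ} (hc : 0 < c) :
    AdmissibleParamsG B B.dd c := by
  classical
  set n := Fintype.card (β ⊕ (γ ⊕ δ)) with hn'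
  have hn : 1 ≤ n := by omega
  set cg := Fintype.card (Gen β γ δ) with hcg
  -- the ratio `ℓ`
  set K : ℝ := c * ((κD n B.dd : ℕ) : ℝ) ^ n * (n.factorial : ℝ) with hK
  have hK0 : 0 ≤ K := by positivity
  set ℓ : ℕ := ⌈K⌉₊ + 1 with hℓ
  have hℓ1 : 1 ≤ ℓ := by omega
  have hℓc : K < ℓ := by
    have h1 := Nat.le_ceil K
    rw [hℓ]; push_cast; linarith
  -- the base
  set Gn : ℕ := ⌈B.bigConst⌉₊ with hGn
  have hGG : B.bigConst ≤ Gn := Nat.le_ceil _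
  have hG2 : 2 ≤ Gn := by
    have h2 := B.bigConst_spec.1
    have : (2 : ℝ) ≤ (Gn : ℝ) := h2.trans hGG
    exact_mod_cast this
  -- the exponents
  set F₀ : FamilyG := ⟨1, 0, ℓ, Gn, hℓ1, hG2, le_rfl⟩ with hF₀
  set b : ℕ := F₀.b₀ n B.gens.h cg with hb
  set a : ℕ := 9 * (n * ℓ + 1) ^ 2 + 2 * b + 2 with ha
  have ha1 : 1 ≤ a := by omega
  set F : FamilyG := ⟨a, b, ℓ, Gn, hℓ1, hG2, ha1⟩ with hF
  have hbF : F.b₀ n B.gens.h cg ≤ F.b := le_of_eq rfl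
  have haF : 9 * (n * F.ℓ + 1) ^ 2 + 2 * F.b + 2 ≤ F.a := le_of_eq rfl
  have hGGF : B.bigConst ≤ F.G := hGG
  -- thresholds
  set K₀ : ℕ := ⌈K⌉₊ + 1 with hK₀
  set σ : ℕ := 1 + κD n B.dd + 18 * n * B.gens.h * (n * F.a + F.E₀ n B.dd B.hdeg) +
    F.CD n B.gens.h B.hdeg cg * κD n B.dd + K₀ with hσ
  have hσ1 : 1 ≤ σ := by rw [hσ]; omega
  have hσκ : κD n B.dd ≤ σ := by rw [hσ]; omega
  have hσω : 18 * n * B.gens.h * (n * F.a + F.E₀ n B.dd B.hdeg) ≤ σ := by rw [hσ]; omega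
  have hσD : F.CD n B.gens.h B.hdeg cg * κD n B.dd ≤ σ := by rw [hσ]; omega
  have hσK₀ : K₀ ≤ σ := by rw [hσ]; omega
  have hσK : K ≤ σ := by
    have h1 := Nat.le_ceil K
    have h2 : (K₀ : ℝ) ≤ σ := by exact_mod_cast hσK₀
    rw [hK₀] at h2; push_cast at h2; linarith
  have hΘK : K * (σ : ℝ) ^ n < F.Θ n σ := F.ΘK_lt hn hσ1 hσK
  -- the parameters
  obtain ⟨hR0, hR2⟩ := F.R_bounds n hn hσ1
  refine ⟨F.D' n B.dd σ, F.T n σ, S₀ n σ, F.S n σ, F.T₂ n σ, F.R n σ,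
    F.T_pos n hn σ, F.one_le_D' n B.dd hn hσ1, F.one_le_S n hσ1,
    F.siegel_feasible n B.dd hn hσ1, hR0, hR2, ?_, ?_⟩
  · intro ξ hξ
    exact B.numCond₂_familyG F hn'.symm hn hdd hbF haF hGGF hσ1 hσκ hσω hσD hξ
  · intro e m hm hidx
    exact F.numerics n B.dd hn hdd hc hℓc hσ1 hΘK e m hm hidx

end BakerDataG

end Std

end GaGmE

end Literature.NumberTheory.Transcendental

end
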